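import Literature.Topology.FourManifolds.BordismFour
import Literature.AlgebraicTopology.SingularHomology.LefschetzDuality
import Literature.AlgebraicTopology.SingularHomology.DisjointUnion
import Literature.AlgebraicTopology.SingularHomology.UniversalCoefficients
import Mathlib.LinearAlgebra.Dimension.Localization
import Mathlib.RingTheory.Finiteness.Prod
import Mathlib.Topology.Homeomorph.Lemmas
import HarnessLib

/-!
# `Literature.Topology.FourManifolds.isOrientedBordant_iff_signature_eq`: Thom's architecture (sibling proof file)

Proof file (sibling of `Literature.Topology.FourManifolds.BordismFour`) for the named fact
`Literature.Topology.FourManifolds.isOrientedBordant_iff_signature_eq` (statement `spc4.S36`: two closed oriented smooth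
4-manifolds are oriented bordant iff their signatures agree, i.e. `σ : Ω₄^SO → ℤ` is injective).

## The printed proof (R. Thom, *Quelques propriétés globales des variétés différentiables*,
Comment. Math. Helv. 28 (1954) 17–86)

* Setting (Ch. IV §1, p. 64): compact oriented `C^∞` manifolds; the orientation induced on a
  boundary is *defined* through the connecting map `∂ : H_{n+1}(M^{n+1}, V^n) → H_n(V^n)`, and
  "`V^n` orientée est une variété-bord" means `V = ∂M` for a compact orientable `M` some
  orientation of which induces the given one on `V` — this is exactly the homological relation
  `Literature.Topology.FourManifolds.IsOrientedBordant` of the statement file (a class `w ∈ H₅(W, ∂W; ℤ)` with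
  `∂w = (inl)_*[M]_μ − (inr)_*[N]_ν`).
* (⇒) **Thm IV.1** (Ch. IV §2, p. 65): "Si deux variétés `V`, `V'`, orientées, de dimension `4k`,
  sont cobordantes, les formes quadratiques définies par le cup-produit sur `H^{2k}(V)` resp.
  `H^{2k}(V')` ont même index `τ`" — deduced there from Thom (1952, Ann. ENS 69) **Cor. V.11**
  ("théorème V.11 de [27]" in loc. cit.): "Si une variété `P^{4k}` orientée est une
  variété-bord, l'index `τ` ... est nul", plus additivity of `τ` under disjoint union and
  `τ(−V) = −τ(V)`.  In Thom (1952), Ch. V, Cor. V.11 is proved as Thm V.7 + Cor. V.8 ⟹ Thm V.10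
  ⟹ Cor. V.11: for `V = ∂M` (`M` compact orientable, field coefficients) the image
  `Aᵖ = f^* Hᵖ(M) ⊂ Hᵖ(V)` and `A^{n−p}` are each other's annihilator under the cup product
  (Thm V.7, from the Poincaré–Lefschetz duality Thm V.4–Cor. V.5), so `r_p + r_{n−p} = b_p(V)`,
  `r_p = rank Aᵖ` (Cor. V.8); for `n = 4k`, `p = 2k` this makes `A^{2k}` an isotropic subspace of
  half dimension (Thm V.10), which forces `τ = 0` since the "indice d'inertie" of a nondegenerate
  form is `Inf(p, b − p)` (Cor. V.11, p. 176).
* (⇐) **Thm IV.13** (Ch. IV §8, p. 81): `Ω⁴ = ℤ`, and (loc. cit.) "le générateur de `Ω⁴` est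
  représenté par le plan projectif complexe `PC(2)`", for which `τ = 1` (proof of Cor. IV.14).
  Hence `τ : Ω⁴ → ℤ` is a non-zero homomorphism out of an infinite cyclic group, so it is
  injective: equal index implies cobordant.  (Announced by Rokhlin, Dokl. Akad. Nauk SSSR 84 (1952);
  geometric proof: R. Kirby, *The topology of 4-manifolds*, LNM 1374 (1989), Ch. VIII Thm 1(A),
  Ch. IX Thm 1 and Cor. IX.2 "`Ω₄^SO = ℤ` and the isomorphism is given by the index"; textbook
  statement: A. Juhász, *Differential and low-dimensional topology* (2023), §1.7.)

## What this file does

Triage: XL.  Neither direction is within reach of Mathlib/`Literature` today: (⇒) needs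
Poincaré–Lefschetz duality for compact manifolds with boundary (only closed Poincaré duality is
vendored, as named facts, in `Literature.AlgebraicTopology.SingularHomology.PoincareDuality`) and
even the existence of fundamental classes is still the named fact
`Literature.AlgebraicTopology.SingularHomology.existsUnique_isFundamentalClass`; (⇐) is Thom's computation of `Ω⁴` (transversality,
Pontryagin–Thom construction `Ωₖ ≅ π_{n+k}(MSO(n))`, Thm IV.8, and the Serre `𝒞`-theory computation
Thm II.16), or Rokhlin's / Kirby's surgery-theoretic proof — a theory of its own.

Following the `provefact` protocol for XL facts, this file vendors the nodes of Thom's argument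
as NAMED FACTS with their own theorem numbers and PROVES the edges between them.

*Layer 1 (Thom 1954, the two halves).*

* `Literature.Topology.FourManifolds.signature_eq_of_isOrientedBordant` — Thm IV.1 in dimension `4` (⇒);
* `Literature.Topology.FourManifolds.isOrientedBordant_of_signature_eq` — Thm IV.13 with the generator remark (⇐);
* `Literature.Topology.FourManifolds.signature_eq_zero_of_isOrientedBordant_of_isEmpty` — Thom (1952) Cor. V.11 in
  dimension `4`: an oriented boundary has signature `0`;
* `Literature.Topology.FourManifolds.isOrientedBordant_of_isEmpty_of_signature_eq_zero` — the classical form of the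
  injectivity of `τ` (Kirby 1989, Cor. IX.2: a signature-zero closed oriented 4-manifold bounds);

with the proved edges `isOrientedBordant_iff_signature_eq_iff : … ↔ (⇒) ∧ (⇐)` (the
decomposition is lossless), `isOrientedBordant_iff_signature_eq_of h₁ h₂`, IV.1 ⟹ V.11 and
IV.13 ⟹ (null-bordism form), both via the proved `σ(∅) = 0`.

*Layer 2 (inside Thm IV.1: Thom 1952, Ch. V, applied to the whole boundary `∂W = M ⊔ N̄`).*
Thom's `A² = i^* H²(W) ⊂ H²(∂W)` is vendored, reduced modulo torsion, as the sublattice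
`Literature.Topology.FourManifolds.Cobordism.boundaryImage` of `H²(M; ℤ)/T ⊕ H²(N; ℤ)/T` (`Literature.Topology.FourManifolds.freeCohomologyPair`, the free
cohomology of `∂W ≅ M ⊔ N` split along the two ends), of rank `Literature.Topology.FourManifolds.Cobordism.boundaryImageRank`
(Thom's `r₂`).

* PROVED (`Literature.Topology.FourManifolds.Cobordism.intersectionForm_eq_of_mem_boundaryImage`, the inclusion
  `A² ⊆ (A²)^⊥` of Thm V.7): `A²` is totally isotropic for the form `Q_μ ⊕ (−Q_ν)` of the
  oriented boundary `∂w = (inl)_*[M]_μ − (inr)_*[N]_ν` — from naturality of `⌣` and of the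
  Kronecker pairing and `i_* ∘ ∂ = 0` in the exact sequence of the pair `(W, ∂W)`, all proved in
  `Literature.AlgebraicTopology.SingularHomology`.
* NAMED FACT `Literature.Topology.FourManifolds.two_mul_boundaryImageRank_eq` — Cor. V.8 for `n = 4`, `p = 2`:
  `2 r₂ = b₂(∂W) = b₂(M) + b₂(N)`.  This is the only input from Poincaré–Lefschetz duality.
* PROVED `Literature.Topology.FourManifolds.signature_eq_of_isOrientedBordant_of_boundaryImageRank`: Cor. V.8 ⟹ Thm IV.1,
  relative to two standing named facts of `Literature` about closed 4-manifolds taken as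
  hypotheses — `Literature.AlgebraicTopology.SingularHomology.sigPos_add_sigNeg_intersectionForm` (`b₂⁺ + b₂⁻ = b₂`, Sylvester for the
  unimodular form; `Literature.AlgebraicTopology.SingularHomology.IntersectionForm`) and
  `Literature.AlgebraicTopology.SingularHomology.finite_singularCohomology_of_compactSpace` (`…PoincareDuality`) — through the algebra of
  p. 176 proved here in Mathlib generality (`Literature.Topology.FourManifolds.sigPos_add_finrank_le_of_nonpos`, Thom's
  `p ≤ b − r` over any linearly ordered domain; `Literature.Topology.FourManifolds.sigPos_add_sigNeg_eq_of_graph`: two forms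
  with `b⁺ + b⁻ = b` whose orthogonal difference `Q₁ ⊕ (−Q₂)` admits an isotropic submodule of
  half rank have the same index).  Applying Ch. V to `∂W = M ⊔ N̄` directly, instead of to a
  one-ended "variété-bord", is what makes the additivity bookkeeping of Ch. IV §2
  (`τ(V ⊔ V') = τ(V) + τ(V')`, `τ(−V) = −τ(V)`, which would need `ℤ`-orientations of disjoint
  unions, absent from `Literature`) unnecessary.
* PROVED the one-ended specialisations printed by Thom: Thm V.10 for `k = 1`
  (`exists_isotropic_of_isOrientedBordant_of_isEmpty_of`) and Thm V.10 ⟹ Cor. V.11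
  (`signature_eq_zero_of_isOrientedBordant_of_isEmpty_of_exists_isotropic`).
* PROVED the assembly `isOrientedBordant_iff_signature_eq_of_boundaryImageRank`: spc4.S36 from
  Cor. V.8, Sylvester, finiteness and Thm IV.13.

*Layer 3 (inside Cor. V.8: Poincaré–Lefschetz duality, universal coefficients, additivity).*
The leaf `two_mul_boundaryImageRank_eq` is PROVED for cobordisms carrying a **relative
fundamental class** (the printed hypothesis of Thom's Ch. V, "`M^{n+1}` compact orientable"):
`Literature.Topology.FourManifolds.two_mul_boundaryImageRank_eq_of_isRelFundamentalClass`, from the standard textbook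
theorems vendored as named facts in `Literature.AlgebraicTopology.SingularHomology` —
Lefschetz duality `Hᵏ(W) ≅ H₅₋ₖ(W, ∂W)` (Spanier Thm. 6.3.12 / Hatcher Thm. 3.43,
`bijective_relCapProduct_of_isRelFundamentalClass`, `LefschetzDuality.lean`), Poincaré duality
of the two closed ends (`bijective_poincareDualityMap`), universal coefficients
(`kroneckerMap_surjective`, `ker_kroneckerMap_le_torsion`, Hatcher Thm. 3.2,
`UniversalCoefficients.lean`), finite generation (Hatcher Cor. A.8–A.9 for the ends, Spanier
Cor. 6.2.21 for `W`) — through the PROVED "half lives, half dies"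
(`two_mul_finrank_range_cohomologyMap_eq`: the ladder `H²(W) → H²(∂W) → H³(W, ∂W)` over
`H₃(W, ∂W) → H₂(∂W) → H₂(W)` with the boundary formula `∂(a ⌢ w) = ±i^*a ⌢ ∂w`,
`RelativeCapProduct.lean`), the PROVED rank identity `rank im i^* = rank im i_*`
(`finrank_range_cohomologyMap_eq_finrank_range_homologyMap`), the PROVED additivity
`H(∂W) ≅ H(M) ⊕ H(N)` along the homeomorphism `M ⊕ N ≃ₜ ∂W` (`Literature.Topology.FourManifolds.Cobordism.boundaryHomeomorph`,
`DisjointUnion.lean`), and the PROVED translation `r₂ = rank im(i^* : H²(W) → H²(∂W))`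
(`Literature.Topology.FourManifolds.Cobordism.boundaryImageRank_eq_finrank_range`: reduction modulo torsion does not change
ranks).  What separates this from the leaf `two_mul_boundaryImageRank_eq` itself is the
bookkeeping that discards the closed components of `W` (on which the class `w` of
`IsOrientedBordant` need not be a fundamental class): components of `W` meeting `∂W`, Spanier
Thm. 6.3.3/6.3.5 (vendored in `LefschetzDuality.lean`), and additivity for the clopen
decomposition — the next layer.  Since nothing here uses smoothness, the theorem is also recorded
for a bare **topological boundary splitting** `∂W = M ⊔ N` (`Literature.Topology.FourManifolds.BoundarySplitting`: continuous
disjoint injections of the ends onto the boundary of a compact topological manifold with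
boundary), `Literature.Topology.FourManifolds.BoundarySplitting.two_mul_restrictRank_eq_of_isRelFundamentalClass`, the form in
which the next layer applies it to the open submanifold `W'` (where no smooth embedding data is
available or needed); `Cobordism.boundaryImageRank_eq_restrictRank` bridges the two.  Finally
the leaf itself is reduced (PROVED, `Literature.Topology.FourManifolds.two_mul_boundaryImageRank_eq_of_normalization`,
and the assembly `isOrientedBordant_iff_signature_eq_of_normalization`) to the normalization
hypothesis `hA1` — every homological bordism datum `(c, w)` has an `Literature.Topology.FourManifolds.OrientedSplitting` (a
relative fundamental class on a compact topological 5-manifold with boundary `M ⊔ N`) with the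
same `r₂` — plus the textbook named facts; proving `hA1` is the next layer.

It also proves the elementary structure of the homological oriented-bordism relation
`Literature.Topology.FourManifolds.IsOrientedBordant` that Thom's bookkeeping uses: symmetry (reverse the cobordism, negate
the relative class) and compatibility with orientation reversal (relative to the named fact
`HomologicalOrientation.fundamentalClass_neg`, Hatcher p. 236), and the sanity value
`σ(M, μ) = 0` for the empty 4-manifold (its cohomology vanishes: there are no singular simplices).

`isOrientedBordant_iff_signature_eq_holds` (no hypotheses) waits for proofs of the two leaves —
Poincaré–Lefschetz duality in the form `two_mul_boundaryImageRank_eq` (Cor. V.8) and `Ω⁴ ↪ ℤ`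
(`isOrientedBordant_of_signature_eq`, Thm IV.13) — and of the two standing named facts
`sigPos_add_sigNeg_intersectionForm`, `finite_singularCohomology_of_compactSpace`.

## Status of the injectivity half `Ω⁴ ↪ ℤ` (2026-08-16)

Of the four layer-1 facts only the two equivalent injectivity statements
`isOrientedBordant_of_signature_eq` (Thm IV.13) and `isOrientedBordant_of_isEmpty_of_signature_eq_zero`
(Kirby Cor. IX.2) are still undischarged; `signature_eq_of_isOrientedBordant_holds`
(`SignatureBordismInvariance.lean`), `signature_eq_zero_of_isOrientedBordant_of_isEmpty_holds`,
`exists_isotropic_of_isOrientedBordant_of_isEmpty_holds` (`BordismFourSignatureZero.lean`) and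
`two_mul_boundaryImageRank_eq_holds` (`BordismFourDuality.lean`) are theorems.  For the remaining
debt the tree PROVES:

* the two injectivity facts are equivalent, in every universe (`isOrientedBordant_of_isEmpty_of_signature_eq_zero_of`
  below; `isOrientedBordant_of_signature_eq_of_isEmpty`, `BordismFourNullBordism.lean`; universe
  reduction `BordismFourUniverse.lean`), and `Ω₄` is a group under `⊔` with `σ` additive
  (`BordismFourSumBounds.lean`, `BordismFourTransitivity.lean`, `BordismTransitivity.lean`);
* reduction to CONNECTED closed oriented `M : Type` (`isOrientedBordant_of_isEmpty_of_signature_eq_zero_of_connected'`,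
  `BordismOrientedMerging.lean`: oriented merging `M₁ ⊔ M₂ ∼ M₁ # M₂`; `BordismFourComponents.lean`),
  and to Kirby's printed form "a connected signature-zero `M` bounds a smoothly oriented `W⁵`"
  (`isOrientedBordant_of_isEmpty_of_signature_eq_zero_of_smoothOrientation`, `BordismFourOrientableBoundary.lean`);
* Kirby's first step `W₁` of the proof of VIII Thm 1(A) ("make `M` 1-connected by 2-handles"):
  the trace of a surgery is an oriented bordism preserving `σ` (Milnor 1965 Thm. 3.12:
  `MilnorTraceModel.lean`, `SurgeryTrace.lean`, `SurgeryTraceCobordism.lean`, `SurgeryTraceTop.lean`,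
  `SurgeryTraceOrientation.lean`), surgery on a framed circle kills its class (Kosinski X Lemma 1.2,
  `SurgeryKillsLoop.lean`), classes of `π₁` are embedded circles (`LoopsAsEmbeddedCircles.lean`), `π₁`
  of a compact manifold is finitely generated (`CompactManifoldFundamentalGroupFG.lean`), whence
  `exists_simplyConnectedSpace_isOrientedBordant_signature_eq` and the reduction to SIMPLY CONNECTED
  `M` (`isOrientedBordant_of_isEmpty_of_signature_eq_zero_of_simplyConnected[_smoothOrientation]`,
  `KirbySimplyConnectedSurgery.lean`);
* Kirby's last step `W₄` = VIII Thm 3 for `Q = Sⁿ⁺²` (2026-08-16): *a connected compact `n`-manifold,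
  `n ≥ 1`, with a framed tubular embedding of codimension two into `Sⁿ⁺²` bounds a compact smoothly
  oriented `(n+1)`-manifold* (`FramedTubularEmbedding.exists_nullCobordism_smoothOrientation`,
  `FramedCodimTwoBounds.lean`): the linking homomorphism `π₁(Sⁿ⁺² ∖ M) → ℤ` by Mayer–Vietoris and
  Hurewicz (`CodimTwoLinkingHomomorphism[Connected].lean`), re-trivialisation of the normal framing
  by `H¹(M; ℤ) = [M, S¹]` so that the pushoffs are unlinked (`CodimTwoPushoffTwist.lean`), the
  circle-valued map of the complement equal to the fibre angle near `M` by the lifting criterion and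
  Brown–Sard (`CodimTwoCircleMap.lean`), and the Seifert hypersurface `M ∪ θ⁻¹{v}` as a regular
  sublevel manifold with boundary `M`, oriented (`SeifertHypersurfaceLevel.lean`,
  `SeifertHypersurfaceBoundary.lean`); whence, in dimension four,
  `FramedTubularEmbedding.isOrientedBordant_of_isEmpty` and the reduction
  `isOrientedBordant_of_isEmpty_of_signature_eq_zero_of_framedEmbedding` of this fact to the
  hypothesis `hcore` below.

What remains is precisely (`hcore`): *a simply connected closed smooth `ℤ`-oriented 4-manifold of
signature zero is oriented-bordant to a connected closed smooth 4-manifold admitting a framed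
tubular embedding of codimension two into `S⁶`* (equivalently, by the tree's tubular neighbourhood
theorem `nonempty_framedTubularEmbedding_of_isNormalFraming`, a smooth embedding `M₃ ↪ S⁶` with a
normal `2`-framing) — Kirby VIII Thm 1(A), steps `W₂`, `W₃` with VIII
Thm 2 (Hirsch–Smale immersion `M ↬ ℝ⁶` with algebraically zero triple points by Lemmas VI.1, VI.5,
the 1-handle bordisms of VIII Lemmas 5–6 removing triple and double points, the trivial normal
bundle of the embedded `M₃ ⊂ ℝ⁶`) together with IX Thm 1 (`p₁ = 3σ`); immersion theory of closed
manifolds and Pontryagin classes are not in Mathlib or the tree (nor is the alternative, Thom's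
`π_{n+4}(MSO(n))`; Wall's 1964 route is circular, resting on `Ω₄ = ℤ`; Rokhlin's and Melvin's
proofs need Whitney's immersion theorem and normal Euler classes).

## References

* R. Thom, Comment. Math. Helv. 28 (1954): Ch. IV §1 (p. 64), Thm IV.1 (p. 65), Thm IV.13 and
  Cor. IV.14 (p. 81).
* R. Thom, *Espaces fibrés en sphères et carrés de Steenrod*, Ann. Sci. ENS 69 (1952) 109–182:
  Ch. V, Cor. V.5–Cor. V.8 (p. 173), definition of "variété-bord" (p. 175), Thm V.10 and
  Cor. V.11 (p. 176).
* V. A. Rokhlin, Dokl. Akad. Nauk SSSR 84 (1952) 221–224.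
* R. Kirby, *The topology of 4-manifolds*, LNM 1374 (1989): II §5 Thm 5.2, VIII Thm 1, IX Thm 1,
  Cor. IX.2.
* A. Hatcher, *Algebraic Topology* (2002), §2.1 (singular simplices, exact sequence of the pair),
  §3.1 p. 201 and Prop. 3.10 (naturality), Thm. 3.2 (universal coefficients), §3.3 p. 236
  (`[X]_{-μ} = -[X]_μ`), p. 241 (projection formula), Thm. 3.43 (Lefschetz duality).
* E. Spanier, *Algebraic Topology* (1981), Ch. 6 §2 Cor. 21, §3 Thm. 12.
* J. Milnor, *Lectures on the h-cobordism theorem* (1965), §1 (`∂W = M ⊔ N`).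
-/

open scoped Manifold ContDiff Topology ContinuousMap
open ContinuousMap CategoryTheory

noncomputable section

universe u v

/-! ### Cohomology of the empty space (Hatcher §2.1: no singular simplices) -/

namespace Literature.Topology.FourManifolds

variable {X : Type u} [TopologicalSpace X]

/-- The empty space has no singular simplices: a singular `n`-simplex is a continuous map
`Δⁿ → X` and `Δⁿ ≠ ∅` (Hatcher, *Algebraic Topology* (2002), §2.1). [cite: Hatcher2002, §2.1] -/
instance _root_.Literature.AlgebraicTopology.SingularHomology.SingularSimplex.instIsEmpty [IsEmpty X] (n : ℕ) : IsEmpty (Literature.AlgebraicTopology.SingularHomology.SingularSimplex X n) :=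
  ⟨fun σ => isEmptyElim (Literature.AlgebraicTopology.SingularHomology.SingularSimplex.toContinuousMap σ (Classical.arbitrary _))⟩

/-- The singular cochain modules of the empty space are trivial (cochains are functions on the
empty set of simplices; Hatcher 2002, §2.1 and §3.1). [cite: Hatcher2002, §3.1] -/
instance _root_.Literature.AlgebraicTopology.SingularHomology.singularCochainComplex.subsingleton_X [IsEmpty X] (R : Type v) [CommRing R]
    (M : Type v) [AddCommGroup M] [Module R M] (n : ℕ) :
    Subsingleton ((Literature.AlgebraicTopology.SingularHomology.singularCochainComplex R M X).X n) :=
  ⟨fun _ _ => Literature.AlgebraicTopology.SingularHomology.singularCochainComplex.ext fun σ => isEmptyElim σ⟩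

/-- The singular cohomology of the empty space vanishes in every degree, `Hⁿ(∅; M) = 0`
(Hatcher 2002, §3.1; a subquotient of the zero cochain module). [cite: Hatcher2002, §3.1] -/
instance _root_.Literature.AlgebraicTopology.SingularHomology.singularCohomology.subsingleton_of_isEmpty [IsEmpty X] (R : Type v) [CommRing R]
    (M : Type v) [AddCommGroup M] [Module R M] (n : ℕ) :
    Subsingleton (Literature.AlgebraicTopology.SingularHomology.singularCohomology R M X n) := by
  refine ⟨fun a b => ?_⟩
  induction a using Literature.AlgebraicTopology.SingularHomology.singularCohomology_induction_on with
  | h x =>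
    induction b using Literature.AlgebraicTopology.SingularHomology.singularCohomology_induction_on with
    | h y =>
      have hxy : x = y :=
        (ModuleCat.mono_iff_injective ((Literature.AlgebraicTopology.SingularHomology.singularCochainComplex R M X).iCycles n)).1
          inferInstance (Subsingleton.elim _ _)
      rw [hxy]

/-- Cohomology modulo torsion of the empty space vanishes, `Hᵏ(∅; R)/T = 0` (Hatcher 2002, §3.1
and §3.3 p. 250). [cite: Hatcher2002, §3.1] -/
instance _root_.Literature.AlgebraicTopology.SingularHomology.freeCohomology.subsingleton_of_isEmpty [IsEmpty X] (R : Type v) [CommRing R] (k : ℕ) :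
    Subsingleton (Literature.AlgebraicTopology.SingularHomology.freeCohomology R X k) :=
  (Literature.AlgebraicTopology.SingularHomology.freeCohomology.mk_surjective (R := R) (X := X) (k := k)).subsingleton

end Literature.Topology.FourManifolds

namespace Literature.Topology.FourManifolds

/-! ### Elementary structure of the homological oriented-bordism relation -/

section Structure

variable {n : ℕ} {M N : Type u} [TopologicalSpace M] [ChartedSpace (EuclideanSpace ℝ (Fin n)) M]
  [TopologicalSpace N] [ChartedSpace (EuclideanSpace ℝ (Fin n)) N]

/-- Reversing a cobordism exchanges the two corestricted boundary inclusions: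
`(c.symm).inlBoundary = c.inrBoundary` (Milnor, *h-cobordism* (1965), §1; definitional).
[folklore] -/
theorem Cobordism.symm_inlBoundary (c : Cobordism n M N) :
    c.symm.inlBoundary = c.inrBoundary :=
  rfl

/-- Reversing a cobordism exchanges the two corestricted boundary inclusions:
`(c.symm).inrBoundary = c.inlBoundary` (Milnor, *h-cobordism* (1965), §1; definitional).
[folklore] -/
theorem Cobordism.symm_inrBoundary (c : Cobordism n M N) :
    c.symm.inrBoundary = c.inlBoundary :=
  rfl

/-- **Oriented bordism is symmetric.**  If `(M, μ)` and `(N, ν)` are oriented bordant through `W`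
with relative class `w`, `∂w = (inl)_*[M]_μ − (inr)_*[N]_ν`, then the reversed cobordism `W` from
`N` to `M` with the class `−w` has `∂(−w) = (inr)_*[N]_ν − (inl)_*[M]_μ`.  This is Thom's
"`V ≃ V'` iff `V' − V` is a boundary" read backwards (Thom 1954, Ch. IV §1, p. 64; Juhász 2023,
Prop. 1.65: `−W̄` is a cobordism from `N` to `M`). [cite: ThomCMH1954, Ch. IV §1 p. 64] -/
theorem IsOrientedBordant.symm {μ : Literature.AlgebraicTopology.SingularHomology.HomologicalOrientation ℤ M n}
    {ν : Literature.AlgebraicTopology.SingularHomology.HomologicalOrientation ℤ N n} (h : IsOrientedBordant n μ ν) :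
    IsOrientedBordant n ν μ := by
  obtain ⟨c, w, hw⟩ := h
  refine ⟨c.symm, -w, ?_⟩
  change (Literature.AlgebraicTopology.SingularHomology.relativeSingularHomology.δ ℤ ℤ c.W ((𝓡∂ (n + 1)).boundary c.W) n) (-w) =
    Literature.AlgebraicTopology.SingularHomology.singularHomology.map ℤ ℤ c.inrBoundary n ν.fundamentalClass -
      Literature.AlgebraicTopology.SingularHomology.singularHomology.map ℤ ℤ c.inlBoundary n μ.fundamentalClass
  rw [map_neg, hw, neg_sub]

variable (n) in
/-- Oriented bordism is symmetric, `iff` form (Thom 1954, Ch. IV §1).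
[cite: ThomCMH1954, Ch. IV §1 p. 64] -/
theorem isOrientedBordant_comm (μ : Literature.AlgebraicTopology.SingularHomology.HomologicalOrientation ℤ M n)
    (ν : Literature.AlgebraicTopology.SingularHomology.HomologicalOrientation ℤ N n) :
    IsOrientedBordant n μ ν ↔ IsOrientedBordant n ν μ :=
  ⟨IsOrientedBordant.symm, IsOrientedBordant.symm⟩

/-- **Oriented bordism is compatible with reversing both orientations**: if `(M, μ) ∼ (N, ν)`
through `(W, w)` then `(M, −μ) ∼ (N, −ν)` through `(W, −w)`, because `[M]_{−μ} = −[M]_μ`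
(Hatcher, *Algebraic Topology* (2002), §3.3 p. 236) — classically: `−W` is an oriented cobordism
between the reversed manifolds (Thom 1954, Ch. IV §1).  The inputs `[X]_{−μ} = −[X]_μ` for
`X = M, N` are the named fact `HomologicalOrientation.fundamentalClass_neg`
(`Literature.AlgebraicTopology.SingularHomology.FundamentalClass`, at `R := ℤ`), taken as
hypotheses. [cite: Hatcher2002, §3.3 p. 236] -/
theorem IsOrientedBordant.neg [CompactSpace M] [T2Space M] [CompactSpace N] [T2Space N]
    (hM : Literature.AlgebraicTopology.SingularHomology.HomologicalOrientation.fundamentalClass_neg (R := ℤ) (X := M) (n := n))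
    (hN : Literature.AlgebraicTopology.SingularHomology.HomologicalOrientation.fundamentalClass_neg (R := ℤ) (X := N) (n := n))
    {μ : Literature.AlgebraicTopology.SingularHomology.HomologicalOrientation ℤ M n} {ν : Literature.AlgebraicTopology.SingularHomology.HomologicalOrientation ℤ N n}
    (h : IsOrientedBordant n μ ν) : IsOrientedBordant n (-μ) (-ν) := by
  obtain ⟨c, w, hw⟩ := h
  refine ⟨c, -w, ?_⟩
  rw [map_neg, hw, hM μ, hN ν, map_neg, map_neg, neg_sub_neg, neg_sub]

end Structure

/-! ### The signature of the empty 4-manifold -/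

/-- **`σ(∅) = 0`.**  The signature of the empty (closed, `ℤ`-oriented) 4-manifold vanishes:
`H²(∅; ℤ)/T = 0` (no singular simplices), so `b₂⁺ = b₂⁻ = 0` (Mathlib `sigPos_le_finrank`).
This is the value `τ(0) = 0` of Thom's homomorphism `τ : Ω⁴ → ℤ` on the class of the empty
manifold (Thom 1954, Ch. IV §2, p. 65: `τ` is additive). [cite: ThomCMH1954, Ch. IV §2 p. 65] -/
theorem _root_.Literature.AlgebraicTopology.SingularHomology.HomologicalOrientation.signature_eq_zero_of_isEmpty {M : Type u}
    [TopologicalSpace M] [IsEmpty M] (μ : Literature.AlgebraicTopology.SingularHomology.HomologicalOrientation ℤ M 4) : μ.signature = 0 := by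
  have h0 : Module.finrank ℤ ↥(Literature.AlgebraicTopology.SingularHomology.freeCohomology ℤ M 2) = 0 := Module.finrank_zero_of_subsingleton
  have h₁ := sigPos_le_finrank (Literature.AlgebraicTopology.SingularHomology.intersectionForm two_add_two_eq_four μ).toQuadraticMap
  have h₂ := sigPos_le_finrank (-(Literature.AlgebraicTopology.SingularHomology.intersectionForm two_add_two_eq_four μ).toQuadraticMap)
  rw [sigPos_neg] at h₂
  rw [h0, Nat.le_zero] at h₁ h₂
  simp only [Literature.AlgebraicTopology.SingularHomology.HomologicalOrientation.signature, LinearMap.BilinForm.signature, h₁, h₂,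
    Nat.cast_zero, sub_zero]

/-! ### Thom's two halves as named facts -/

/-- **Bordism invariance of the signature in dimension four** (Thom, Comment. Math. Helv. 28
(1954), **Thm IV.1** with `k = 1`: "Si deux variétés `V`, `V'`, orientées, de dimension `4k`, sont
cobordantes, les formes quadratiques définies par le cup-produit sur `H^{2k}(V)` resp.
`H^{2k}(V')` ont même index `τ`"; via Thom (1952) Cor. V.11, an oriented boundary has index `0`.
Also Kirby, LNM 1374 (1989), II §5 Thm 5.2; Juhász (2023), p. 171.)  In the setting of
`isOrientedBordant_iff_signature_eq` (closed smooth 4-manifolds `M`, `N` — Hausdorff, second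
countable, compact, `ChartedSpace (EuclideanSpace ℝ (Fin 4))`, `IsManifold (𝓡 4) ∞` — with
homological `ℤ`-orientations `μ`, `ν`, oriented bordism in the homological sense
`IsOrientedBordant 4 μ ν`, signature `σ = b₂⁺ − b₂⁻` of the cup-product form on `H²(−; ℤ)/T`):
**if `(M, μ)` and `(N, ν)` are oriented bordant then `σ(M, μ) = σ(N, ν)`.**  The forward half
of `spc4.S36`. [cite: ThomCMH1954, Thm IV.1] -/
def signature_eq_of_isOrientedBordant : Prop :=
  ∀ {M N : Type u} [TopologicalSpace M] [T2Space M] [SecondCountableTopology M]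
    [ChartedSpace (EuclideanSpace ℝ (Fin 4)) M] [CompactSpace M] [IsManifold (𝓡 4) ∞ M]
    [TopologicalSpace N] [T2Space N] [SecondCountableTopology N]
    [ChartedSpace (EuclideanSpace ℝ (Fin 4)) N] [CompactSpace N] [IsManifold (𝓡 4) ∞ N]
    (μ : Literature.AlgebraicTopology.SingularHomology.HomologicalOrientation ℤ M 4) (ν : Literature.AlgebraicTopology.SingularHomology.HomologicalOrientation ℤ N 4),
    IsOrientedBordant 4 μ ν → μ.signature = ν.signature

/-- **The signature detects oriented bordism in dimension four** (Thom, Comment. Math. Helv. 28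
(1954), **Thm IV.13**: `Ω⁴ = ℤ`, with the remark following it (Ch. IV §8, p. 81) "le générateur de
`Ω⁴` est représenté par le plan projectif complexe `PC(2)`", of index `τ = 1` (proof of
Cor. IV.14); since `τ : Ω⁴ → ℤ` is additive (Thm IV.1) and non-zero on the generator of
`Ω⁴ ≅ ℤ`, it is injective.  Announced by Rokhlin, Dokl. Akad. Nauk SSSR 84 (1952); geometric
proof in Kirby, LNM 1374 (1989), VIII Thm 1(A), IX Thm 1 and Cor. IX.2 "`Ω₄^SO = ℤ` and the
isomorphism is given by the index"; Juhász (2023), §1.7).  In the setting of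
`isOrientedBordant_iff_signature_eq`: **if two closed smooth `ℤ`-oriented 4-manifolds have equal
signature, `σ(M, μ) = σ(N, ν)`, then they are oriented bordant, `IsOrientedBordant 4 μ ν`**
(equivalently: a closed oriented smooth 4-manifold of signature `0` bounds a compact oriented
smooth 5-manifold).  The converse half of `spc4.S36`.
[cite: ThomCMH1954, Thm IV.13 and Ch. IV §8 p. 81] -/
def isOrientedBordant_of_signature_eq : Prop :=
  ∀ {M N : Type u} [TopologicalSpace M] [T2Space M] [SecondCountableTopology M]
    [ChartedSpace (EuclideanSpace ℝ (Fin 4)) M] [CompactSpace M] [IsManifold (𝓡 4) ∞ M]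
    [TopologicalSpace N] [T2Space N] [SecondCountableTopology N]
    [ChartedSpace (EuclideanSpace ℝ (Fin 4)) N] [CompactSpace N] [IsManifold (𝓡 4) ∞ N]
    (μ : Literature.AlgebraicTopology.SingularHomology.HomologicalOrientation ℤ M 4) (ν : Literature.AlgebraicTopology.SingularHomology.HomologicalOrientation ℤ N 4),
    μ.signature = ν.signature → IsOrientedBordant 4 μ ν

/-- **The signature of an oriented boundary vanishes** (Thom, Ann. Sci. ENS 69 (1952),
**Cor. V.11**, p. 176, quoted as "théorème V.11 de [27]" in Thom, Comment. Math. Helv. 28 (1954),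
Ch. IV §2, p. 65: "Si une variété `P^{4k}` orientée est une variété-bord, l'index `τ` de la forme
quadratique définie par le cup-produit sur `H^{2k}(P^{4k})` est nul"; here `k = 1`.  Also
Kirby, LNM 1374 (1989), II §5 Thm 5.2 "if `M⁴` bounds an orientable `W⁵` then `σ(M) = 0`", for
`∂W = M` as oriented manifolds; Juhász (2023), p. 171).  In the homological setting of
`isOrientedBordant_iff_signature_eq`, "`(P, π)` is an oriented boundary" is
`IsOrientedBordant 4 π ν` with an EMPTY second end `N` (so `∂W = inl P` and the relative class
`w ∈ H₅(W, ∂W; ℤ)` has `∂w = (inl)_*[P]_π`, Thom's definition of "variété-bord", Ch. IV §1 p. 64;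
Thom 1952, p. 175): **for closed smooth `ℤ`-oriented 4-manifolds `P` and `N` with `N` empty,
`IsOrientedBordant 4 π ν → σ(P, π) = 0`.**  This is the node under Thm IV.1 in Thom's argument
(IV.1 = V.11 + additivity of `τ` under `⊔` + `τ(−V) = −τ(V)`).
[cite: Thom1952, Cor. V.11 (p. 176), quoted in ThomCMH1954 Ch. IV §2 p. 65] -/
def signature_eq_zero_of_isOrientedBordant_of_isEmpty : Prop :=
  ∀ {P N : Type u} [TopologicalSpace P] [T2Space P] [SecondCountableTopology P]
    [ChartedSpace (EuclideanSpace ℝ (Fin 4)) P] [CompactSpace P] [IsManifold (𝓡 4) ∞ P]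
    [TopologicalSpace N] [T2Space N] [SecondCountableTopology N]
    [ChartedSpace (EuclideanSpace ℝ (Fin 4)) N] [CompactSpace N] [IsManifold (𝓡 4) ∞ N] [IsEmpty N]
    (π : Literature.AlgebraicTopology.SingularHomology.HomologicalOrientation ℤ P 4) (ν : Literature.AlgebraicTopology.SingularHomology.HomologicalOrientation ℤ N 4),
    IsOrientedBordant 4 π ν → π.signature = 0

/-! ### The reductions -/

/-- **Reduction of `isOrientedBordant_iff_signature_eq` (spc4.S36) to Thom's Thm IV.1 and
Thm IV.13.**  Given bordism invariance of the signature (`signature_eq_of_isOrientedBordant`,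
Thm IV.1) and injectivity of the signature on `Ω₄^SO` (`isOrientedBordant_of_signature_eq`,
Thm IV.13 with the generator `ℂℙ²`), two closed smooth `ℤ`-oriented 4-manifolds are oriented
bordant iff their signatures agree — exactly as in Thom (1954), Ch. IV §8, and Kirby (1989),
Cor. IX.2.  PROVED (assembly of the two halves). [cite: ThomCMH1954, Thm IV.1 and Thm IV.13] -/
theorem isOrientedBordant_iff_signature_eq_of (h₁ : signature_eq_of_isOrientedBordant.{u})
    (h₂ : isOrientedBordant_of_signature_eq.{u}) : isOrientedBordant_iff_signature_eq.{u} := by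
  intro M N _ _ _ _ _ _ _ _ _ _ _ _ μ ν
  exact ⟨h₁ μ ν, h₂ μ ν⟩

/-- The forward half is a consequence of the full statement (so the decomposition loses nothing):
`isOrientedBordant_iff_signature_eq → signature_eq_of_isOrientedBordant` (Thom 1954, Thm IV.1
as a corollary of `σ : Ω⁴ ≅ ℤ`). [cite: ThomCMH1954, Thm IV.1] -/
theorem signature_eq_of_isOrientedBordant_of (h : isOrientedBordant_iff_signature_eq.{u}) :
    signature_eq_of_isOrientedBordant.{u} := by
  intro M N _ _ _ _ _ _ _ _ _ _ _ _ μ ν hb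
  exact (h μ ν).1 hb

/-- The converse half is a consequence of the full statement (so the decomposition loses nothing):
`isOrientedBordant_iff_signature_eq → isOrientedBordant_of_signature_eq` (Thom 1954, Thm IV.13
as a corollary of `σ : Ω⁴ ≅ ℤ`). [cite: ThomCMH1954, Thm IV.13] -/
theorem isOrientedBordant_of_signature_eq_of (h : isOrientedBordant_iff_signature_eq.{u}) :
    isOrientedBordant_of_signature_eq.{u} := by
  intro M N _ _ _ _ _ _ _ _ _ _ _ _ μ ν hσ
  exact (h μ ν).2 hσ

/-- **The decomposition is exact**: `isOrientedBordant_iff_signature_eq` (spc4.S36, `σ` injective on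
`Ω₄^SO`) is equivalent to the conjunction of Thom's Thm IV.1 in dimension `4`
(`signature_eq_of_isOrientedBordant`) and of the injectivity half of Thm IV.13
(`isOrientedBordant_of_signature_eq`).  PROVED. [cite: ThomCMH1954, Thm IV.1 and Thm IV.13] -/
theorem isOrientedBordant_iff_signature_eq_iff :
    isOrientedBordant_iff_signature_eq.{u} ↔
      signature_eq_of_isOrientedBordant.{u} ∧ isOrientedBordant_of_signature_eq.{u} :=
  ⟨fun h => ⟨signature_eq_of_isOrientedBordant_of h, isOrientedBordant_of_signature_eq_of h⟩,
    fun h => isOrientedBordant_iff_signature_eq_of h.1 h.2⟩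

/-- **Thm IV.1 ⟹ Cor. V.11** (the trivial edge of Thom's DAG): bordism invariance of the signature
gives the vanishing of the signature of an oriented boundary, because the empty end has
`σ(∅) = 0` (`HomologicalOrientation.signature_eq_zero_of_isEmpty`).  Thom (1954), Ch. IV §2,
p. 65 derives IV.1 from V.11; this is the converse bookkeeping.  PROVED.
[cite: ThomCMH1954, Ch. IV §2 p. 65] -/
theorem signature_eq_zero_of_isOrientedBordant_of_isEmpty_of
    (h : signature_eq_of_isOrientedBordant.{u}) :
    signature_eq_zero_of_isOrientedBordant_of_isEmpty.{u} := by
  intro P N _ _ _ _ _ _ _ _ _ _ _ _ _ π ν hb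
  rw [h π ν hb, Literature.AlgebraicTopology.SingularHomology.HomologicalOrientation.signature_eq_zero_of_isEmpty]

/-- In particular the full statement `isOrientedBordant_iff_signature_eq` already contains
Thom's Cor. V.11 in dimension `4` (`signature_eq_zero_of_isOrientedBordant_of_isEmpty`).
PROVED. [cite: ThomCMH1954, Ch. IV §2 p. 65] -/
theorem signature_eq_zero_of_isOrientedBordant_of_isEmpty_of'
    (h : isOrientedBordant_iff_signature_eq.{u}) :
    signature_eq_zero_of_isOrientedBordant_of_isEmpty.{u} :=
  signature_eq_zero_of_isOrientedBordant_of_isEmpty_of (signature_eq_of_isOrientedBordant_of h)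


end Literature.Topology.FourManifolds

namespace Literature.Topology.FourManifolds

/-! ### The algebra of Thom (1952), p. 176: forms with a large isotropic submodule

Thom, Ann. Sci. ENS 69 (1952), proof of Cor. V.11 from Thm V.10 (p. 176): over `ℝ` or `ℚ`
"l'indice d'inertie est égal à `Inf(p, b − p)`, `p` désignant le nombre des carrés positifs",
i.e. a submodule on which the form is `≤ 0` meets every positive definite submodule in `0`, so
its rank is at most `b − p`.  Proved here for quadratic forms on finitely generated modules over
a linearly ordered domain (Mathlib's `QuadraticForm.sigPos_add_finrank_le_of_nonpos` is the case
of a field), together with the two consequences used by Thom: an isotropic submodule of half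
rank forces `b⁺ = b⁻` (one form, Thm V.10 ⟹ Cor. V.11), and an isotropic submodule of half rank
for `Q₁ ⊕ (−Q₂)` forces `b⁺(Q₁) − b⁻(Q₁) = b⁺(Q₂) − b⁻(Q₂)` (two forms: Ch. V applied to the
boundary `∂W = V ⊔ V̄'` of a cobordism, which is how Thm IV.1 of Thom (1954) follows). -/

section IsotropicRank

variable {R : Type*} [CommRing R] [LinearOrder R] [IsStrictOrderedRing R]
  {V : Type*} [AddCommGroup V] [Module R V]
  {V₁ : Type*} [AddCommGroup V₁] [Module R V₁]
  {V₂ : Type*} [AddCommGroup V₂] [Module R V₂]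

omit [LinearOrder R] [IsStrictOrderedRing R] in
/-- Over a domain, two submodules of a finitely generated module meeting in `0` have
`rank s + rank t ≤ rank V` (rank–nullity for `s ⊕ t ≅ s ⊔ t ≤ V`; Mathlib has the division-ring
case `Submodule.finrank_add_finrank_le_of_disjoint`). [folklore] -/
theorem finrank_add_finrank_le_of_disjoint_of_isDomain [IsDomain R] [Module.Finite R V]
    {s t : Submodule R V} (h : Disjoint s t) :
    Module.finrank R s + Module.finrank R t ≤ Module.finrank R V := by
  have key := Submodule.rank_sup_add_rank_inf_eq s t
  rw [h.eq_bot, rank_bot, add_zero] at key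
  have hle : Module.rank R s + Module.rank R t ≤ Module.rank R V := key ▸ Submodule.rank_le _
  have hV : Module.rank R V < Cardinal.aleph0 := Module.rank_lt_aleph0 R V
  have hs : Module.rank R s < Cardinal.aleph0 := (self_le_add_right _ _).trans hle |>.trans_lt hV
  have ht : Module.rank R t < Cardinal.aleph0 := (self_le_add_left _ _).trans hle |>.trans_lt hV
  have := Cardinal.toNat_le_toNat hle hV
  rwa [Cardinal.toNat_add hs ht] at this

omit [LinearOrder R] [IsStrictOrderedRing R] in
/-- Over a domain, two submodules of a finitely generated module meeting in `0` span a submodule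
of rank `rank s + rank t` (rank–nullity, `Submodule.rank_sup_add_rank_inf_eq`). [folklore] -/
theorem finrank_sup_eq_of_disjoint_of_isDomain [IsDomain R] [Module.Finite R V]
    {s t : Submodule R V} (h : Disjoint s t) :
    Module.finrank R ↥(s ⊔ t) = Module.finrank R s + Module.finrank R t := by
  have key := Submodule.rank_sup_add_rank_inf_eq s t
  rw [h.eq_bot, rank_bot, add_zero] at key
  have hV : Module.rank R V < Cardinal.aleph0 := Module.rank_lt_aleph0 R V
  have hs : Module.rank R s < Cardinal.aleph0 := (Submodule.rank_le _).trans_lt hV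
  have ht : Module.rank R t < Cardinal.aleph0 := (Submodule.rank_le _).trans_lt hV
  have := congrArg Cardinal.toNat key
  rwa [Cardinal.toNat_add hs ht] at this

omit [LinearOrder R] [IsStrictOrderedRing R] in
/-- Over a domain, `rank (V₁ × V₂) = rank V₁ + rank V₂` for finitely generated modules
(rank–nullity for the second projection; Mathlib's `Module.finrank_prod` assumes free modules).
[folklore] -/
theorem finrank_prod_of_isDomain [IsDomain R] [Module.Finite R V₁] [Module.Finite R V₂] :
    Module.finrank R (V₁ × V₂) = Module.finrank R V₁ + Module.finrank R V₂ := by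
  have h := Submodule.finrank_quotient_add_finrank (LinearMap.ker (LinearMap.snd R V₁ V₂))
  rw [(LinearMap.quotKerEquivOfSurjective _ LinearMap.snd_surjective).finrank_eq,
    LinearMap.ker_snd, LinearMap.finrank_range_of_inj LinearMap.inl_injective] at h
  omega

omit [LinearOrder R] [IsStrictOrderedRing R] in
/-- Over a domain, `rank (P₁ × P₂) = rank P₁ + rank P₂` for the product of two submodules of
finitely generated modules (`P₁ × P₂ = (P₁ × 0) ⊕ (0 × P₂)`). [folklore] -/
theorem finrank_prod_submodule_of_isDomain [IsDomain R] [Module.Finite R V₁] [Module.Finite R V₂]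
    (P₁ : Submodule R V₁) (P₂ : Submodule R V₂) :
    Module.finrank R ↥(P₁.prod P₂) = Module.finrank R P₁ + Module.finrank R P₂ := by
  rw [LinearMap.prod_eq_sup_map, finrank_sup_eq_of_disjoint_of_isDomain,
    ← (Submodule.equivMapOfInjective _ LinearMap.inl_injective P₁).finrank_eq,
    ← (Submodule.equivMapOfInjective _ LinearMap.inr_injective P₂).finrank_eq]
  rw [Submodule.map_inl, Submodule.map_inr, Submodule.disjoint_def]
  rintro ⟨x, y⟩ hx hy
  simp only [Submodule.mem_prod, Submodule.mem_bot] at hx hy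
  ext <;> simp [hx.2, hy.1]

/-- **Thom's inequality `p ≤ b − r`.**  If a quadratic form `Q` on a finitely generated module
over a linearly ordered domain is `≤ 0` on a submodule `K` of rank `r` (e.g. `K` totally
isotropic), then `b⁺(Q) + r ≤ rank V`: a positive definite submodule meets `K` in `0`
(Thom, Ann. Sci. ENS 69 (1952), proof of Cor. V.11 from Thm V.10, p. 176: "l'indice d'inertie
est égal à `Inf(p, b − p)`"; Mathlib's `QuadraticForm.sigPos_add_finrank_le_of_nonpos` is the
case of a field). [cite: Thom1952, Ch. V §IV p. 176 (Thm V.10, Cor. V.11)] -/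
theorem sigPos_add_finrank_le_of_nonpos [Module.Finite R V] (Q : QuadraticForm R V)
    {K : Submodule R V} (hK : ∀ x ∈ K, Q x ≤ 0) :
    sigPos Q + Module.finrank R K ≤ Module.finrank R V := by
  obtain ⟨P, hP, hpos⟩ := exists_finrank_eq_sigPos_and_posDef Q
  rw [← hP]
  refine finrank_add_finrank_le_of_disjoint_of_isDomain ?_
  rw [Submodule.disjoint_def]
  intro x hxP hxK
  by_contra hx
  have h1 : 0 < Q x := by
    have := hpos ⟨x, hxP⟩ (by simpa using hx)
    simpa using this
  exact lt_irrefl (0 : R) (lt_of_lt_of_le h1 (hK x hxK))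

/-- The negative counterpart of Thom's inequality: if `Q ≥ 0` on a submodule `K` of rank `r`
then `b⁻(Q) + r ≤ rank V` (Thom 1952, proof of Cor. V.11, applied to `−Q`).
[cite: Thom1952, Ch. V §IV p. 176 (Thm V.10, Cor. V.11)] -/
theorem sigNeg_add_finrank_le_of_nonneg [Module.Finite R V] (Q : QuadraticForm R V)
    {K : Submodule R V} (hK : ∀ x ∈ K, 0 ≤ Q x) :
    sigNeg Q + Module.finrank R K ≤ Module.finrank R V := by
  rw [← sigPos_neg]
  exact sigPos_add_finrank_le_of_nonpos (-Q) fun x hx => by simpa using hK x hx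

/-- **The algebra of Thom's Thm V.10 ⟹ Cor. V.11.**  Let `Q` be a quadratic form on a finitely
generated module `V` over a linearly ordered domain with `b⁺ + b⁻ = rank V` (no null part:
Sylvester for a form nondegenerate over the fraction field).  If `V` contains a totally
isotropic submodule of half rank ("indice d'inertie `= ½ b`", the conclusion of Thm V.10), then
`b⁺ = b⁻`, i.e. the index `τ = b⁺ − b⁻` vanishes (Thom, Ann. Sci. ENS 69 (1952), p. 176:
"l'indice d'inertie est égal à `Inf(p, b − p)`", so `Inf(p, b − p) = b/2` forces `p = b/2` and
`τ = p − (b − p) = 0`). [cite: Thom1952, Ch. V §IV p. 176 (Thm V.10, Cor. V.11)] -/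
theorem sigPos_eq_sigNeg_of_isotropic [Module.Finite R V] (Q : QuadraticForm R V)
    {K : Submodule R V} (hK : ∀ x ∈ K, Q x = 0)
    (h2 : 2 * Module.finrank R K = Module.finrank R V)
    (hpn : sigPos Q + sigNeg Q = Module.finrank R V) : sigPos Q = sigNeg Q := by
  have hp := sigPos_add_finrank_le_of_nonpos Q fun x hx => (hK x hx).le
  have hn := sigNeg_add_finrank_le_of_nonneg Q fun x hx => (hK x hx).ge
  omega

/-- **Thom's inequality for a pair of forms.**  Let `Q₁`, `Q₂` be quadratic forms on finitely
generated modules `V₁`, `V₂` over a linearly ordered domain and let `B ⊆ V₁ × V₂` be a submodule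
on which `Q₁ ⊕ (−Q₂)` vanishes (`Q₁ x₁ = Q₂ x₂` for `(x₁, x₂) ∈ B`).  Then
`b⁺(Q₁) + b⁻(Q₂) + rank B ≤ rank V₁ + rank V₂`: if `P₁ ⊆ V₁` is positive definite for `Q₁` and
`P₂ ⊆ V₂` negative definite for `Q₂` then `B ∩ (P₁ × P₂) = 0`.  This is the inequality
"indice d'inertie `≤ b − p`" of Thom (1952), p. 176, for the form `Q₁ ⊕ (−Q₂)` of the oriented
manifold `V' − V`, "réunion de la variété `V'` et de la variété `V` dont on a renversé
l'orientation" (Thom 1954, Ch. IV §1, p. 64), written on `H(V') × H(V)` without forming the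
disjoint union. [cite: Thom1952, Ch. V §IV p. 176 (Thm V.10, Cor. V.11)] -/
theorem sigPos_add_sigNeg_add_finrank_le_of_graph [Module.Finite R V₁] [Module.Finite R V₂]
    (Q₁ : QuadraticForm R V₁) (Q₂ : QuadraticForm R V₂) {B : Submodule R (V₁ × V₂)}
    (hB : ∀ x ∈ B, Q₁ x.1 = Q₂ x.2) :
    sigPos Q₁ + sigNeg Q₂ + Module.finrank R B ≤
      Module.finrank R V₁ + Module.finrank R V₂ := by
  obtain ⟨P₁, hP₁, hpos₁⟩ := exists_finrank_eq_sigPos_and_posDef Q₁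
  obtain ⟨P₂, hP₂, hpos₂⟩ := exists_finrank_eq_sigPos_and_posDef (-Q₂)
  rw [sigPos_neg] at hP₂
  have hdisj : Disjoint B (P₁.prod P₂) := by
    rw [Submodule.disjoint_def]
    rintro ⟨x₁, x₂⟩ hxB hxP
    rw [Submodule.mem_prod] at hxP
    have hq : Q₁ x₁ = Q₂ x₂ := hB _ hxB
    have hn : Q₂ x₂ ≤ 0 := by
      by_cases hx₂ : x₂ = 0
      · simp [hx₂]
      · have := hpos₂ ⟨x₂, hxP.2⟩ (by simpa using hx₂)
        simp only [QuadraticMap.restrict_apply, QuadraticMap.neg_apply] at this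
        exact (neg_pos.mp this).le
    have h1 : x₁ = 0 := by
      by_contra hx₁
      have hp : 0 < Q₁ x₁ := by simpa using hpos₁ ⟨x₁, hxP.1⟩ (by simpa using hx₁)
      exact absurd (hq ▸ hp) (not_lt.mpr hn)
    have h2 : x₂ = 0 := by
      by_contra hx₂
      have := hpos₂ ⟨x₂, hxP.2⟩ (by simpa using hx₂)
      simp only [QuadraticMap.restrict_apply, QuadraticMap.neg_apply] at this
      rw [← hq, h1, map_zero, neg_zero] at this
      exact lt_irrefl _ this
    simp [h1, h2]
  have h := finrank_add_finrank_le_of_disjoint_of_isDomain hdisj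
  rw [finrank_prod_of_isDomain, finrank_prod_submodule_of_isDomain, hP₁, hP₂] at h
  omega

/-- **Equal indices from an isotropic submodule of half rank for `Q₁ ⊕ (−Q₂)`.**  If moreover
`b⁺ + b⁻ = rank` for both forms (no null parts) and `B` has half the total rank, then
`b⁺(Q₁) + b⁻(Q₂) = b⁻(Q₁) + b⁺(Q₂)`, i.e. `b⁺(Q₁) − b⁻(Q₁) = b⁺(Q₂) − b⁻(Q₂)`: the two indices
agree.  (Thom's inequality for `(Q₁, Q₂)` and for `(−Q₁, −Q₂)` gives `b⁺(Q₁) + b⁻(Q₂) ≤ rank B`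
and `b⁻(Q₁) + b⁺(Q₂) ≤ rank B`, and the four numbers add up to `2 · rank B`.)  This is the
algebraic content of Thom (1954), Thm IV.1 ("ont même index `τ`") via Thom (1952), Cor. V.8 and
p. 176. [cite: Thom1952, Ch. V §IV p. 176 (Thm V.10, Cor. V.11)] -/
theorem sigPos_add_sigNeg_eq_of_graph [Module.Finite R V₁] [Module.Finite R V₂]
    (Q₁ : QuadraticForm R V₁) (Q₂ : QuadraticForm R V₂) {B : Submodule R (V₁ × V₂)}
    (hB : ∀ x ∈ B, Q₁ x.1 = Q₂ x.2)
    (h2 : 2 * Module.finrank R B = Module.finrank R V₁ + Module.finrank R V₂)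
    (hpn₁ : sigPos Q₁ + sigNeg Q₁ = Module.finrank R V₁)
    (hpn₂ : sigPos Q₂ + sigNeg Q₂ = Module.finrank R V₂) :
    sigPos Q₁ + sigNeg Q₂ = sigNeg Q₁ + sigPos Q₂ := by
  have ha := sigPos_add_sigNeg_add_finrank_le_of_graph Q₁ Q₂ hB
  have hb := sigPos_add_sigNeg_add_finrank_le_of_graph (-Q₁) (-Q₂) (B := B)
    (fun x hx => by simp [hB x hx])
  rw [sigPos_neg, sigNeg_neg] at hb
  omega

end IsotropicRank

end Literature.Topology.FourManifolds

/-- **Lattice form of Thom's Cor. V.11** (dot-notation extension of Mathlib's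
`LinearMap.BilinForm` namespace, as in `Literature.Topology.FourManifolds.LatticeForms`).  For a
bilinear form `Q` on a finitely generated `ℤ`-module with `b⁺ + b⁻ = rank` admitting a submodule
`K` of half rank on which `x ↦ Q x x` vanishes, the signature `σ(Q) = b⁺ − b⁻` is `0`
(Thom, Ann. Sci. ENS 69 (1952), Thm V.10 and Cor. V.11, p. 176).
[cite: Thom1952, Ch. V §IV p. 176 (Thm V.10, Cor. V.11)] -/
theorem LinearMap.BilinForm.signature_eq_zero_of_isotropic {V : Type*} [AddCommGroup V]
    [Module ℤ V] [Module.Finite ℤ V] (Q : LinearMap.BilinForm ℤ V) {K : Submodule ℤ V}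
    (hK : ∀ x ∈ K, Q x x = 0) (h2 : 2 * Module.finrank ℤ K = Module.finrank ℤ V)
    (hpn : sigPos Q.toQuadraticMap + sigNeg Q.toQuadraticMap = Module.finrank ℤ V) :
    Q.signature = 0 := by
  have h := Literature.Topology.FourManifolds.sigPos_eq_sigNeg_of_isotropic Q.toQuadraticMap (K := K)
    (fun x hx => by simpa using hK x hx)
    (by convert h2 using 4 <;> first | rfl | exact Subsingleton.elim _ _) hpn
  simp [LinearMap.BilinForm.signature, h]

namespace Literature.Topology.FourManifolds

/-! ### Thom's `A² = i^* H²(W) ⊂ H²(∂W)` for a cobordism, reduced modulo torsion -/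

section Pair

variable (R : Type v) [CommRing R]

/-- The module `Hᵏ(M; R)/T ⊕ Hᵏ(N; R)/T`, bundled as an object of `ModuleCat R`: the cohomology
modulo torsion of the disjoint union `M ⊔ N` (the cohomology of a disjoint union is the direct
product of the cohomologies, Hatcher, *Algebraic Topology* (2002), §3.1, p. 202, axiom (3) and
the paragraph following it), presented through the two summands so that no (co)homology of the
sum type `M ⊕ N` is needed.  It is the home of Thom's `A² ⊂ H²(V)` for the boundary
`V = ∂W ≅ M ⊔ N` of a cobordism (`Cobordism.boundaryImage`).  Bundled (rather than the bare
product type) so that its `Module R` instance is `ModuleCat.isModule`, as for `Literature.AlgebraicTopology.SingularHomology.freeCohomology`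
itself. [cite: Hatcher2002, §3.1 p. 202 (cohomology of a disjoint union)] -/
def freeCohomologyPair (M N : Type u) [TopologicalSpace M] [TopologicalSpace N] (k : ℕ) :
    ModuleCat.{max u v} R :=
  ModuleCat.of R (↥(Literature.AlgebraicTopology.SingularHomology.freeCohomology R M k) × ↥(Literature.AlgebraicTopology.SingularHomology.freeCohomology R N k))

/-- Sanity check (ℤ-instance discipline, as in
`Literature.AlgebraicTopology.SingularHomology.PoincareDuality`): at `R := ℤ` the `Module ℤ`
instance found on the carrier of `freeCohomologyPair ℤ M N k` is `ModuleCat.isModule`, i.e.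
`Prod.instModule` of the two `ModuleCat.isModule` structures — and not
`AddCommGroup.toIntModule`, which is what instance resolution picks on the bare product type and
which is not definitionally equal to it. -/
example (M N : Type u) [TopologicalSpace M] [TopologicalSpace N] (k : ℕ) :
    (inferInstance : Module ℤ ↥(freeCohomologyPair ℤ M N k)) = Prod.instModule :=
  rfl

/-- The projection `Hᵏ(M; R)/T ⊕ Hᵏ(N; R)/T → Hᵏ(M; R)/T` onto the first end (restriction to
the component `M ⊂ M ⊔ N`; Hatcher 2002, §3.1 p. 202), as an `R`-linear map out of the bundled
module `freeCohomologyPair` (Mathlib's `LinearMap.fst`). [cite: Hatcher2002, §3.1 p. 202] -/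
def freeCohomologyPair.fst (M N : Type u) [TopologicalSpace M] [TopologicalSpace N] (k : ℕ) :
    ↥(freeCohomologyPair R M N k) →ₗ[R] ↥(Literature.AlgebraicTopology.SingularHomology.freeCohomology R M k) :=
  LinearMap.fst R ↥(Literature.AlgebraicTopology.SingularHomology.freeCohomology R M k) ↥(Literature.AlgebraicTopology.SingularHomology.freeCohomology R N k)

/-- The projection `Hᵏ(M; R)/T ⊕ Hᵏ(N; R)/T → Hᵏ(N; R)/T` onto the second end (restriction to
the component `N ⊂ M ⊔ N`; Hatcher 2002, §3.1 p. 202), as an `R`-linear map out of the bundled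
module `freeCohomologyPair` (Mathlib's `LinearMap.snd`). [cite: Hatcher2002, §3.1 p. 202] -/
def freeCohomologyPair.snd (M N : Type u) [TopologicalSpace M] [TopologicalSpace N] (k : ℕ) :
    ↥(freeCohomologyPair R M N k) →ₗ[R] ↥(Literature.AlgebraicTopology.SingularHomology.freeCohomology R N k) :=
  LinearMap.snd R ↥(Literature.AlgebraicTopology.SingularHomology.freeCohomology R M k) ↥(Literature.AlgebraicTopology.SingularHomology.freeCohomology R N k)

/-- `freeCohomologyPair.fst` is the first projection (unfolding lemma). [folklore] -/
@[simp]
theorem freeCohomologyPair.fst_apply (M N : Type u) [TopologicalSpace M] [TopologicalSpace N]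
    (k : ℕ) (x : ↥(Literature.AlgebraicTopology.SingularHomology.freeCohomology R M k) × ↥(Literature.AlgebraicTopology.SingularHomology.freeCohomology R N k)) :
    freeCohomologyPair.fst R M N k x = x.1 :=
  rfl

/-- `freeCohomologyPair.snd` is the second projection (unfolding lemma). [folklore] -/
@[simp]
theorem freeCohomologyPair.snd_apply (M N : Type u) [TopologicalSpace M] [TopologicalSpace N]
    (k : ℕ) (x : ↥(Literature.AlgebraicTopology.SingularHomology.freeCohomology R M k) × ↥(Literature.AlgebraicTopology.SingularHomology.freeCohomology R N k)) :
    freeCohomologyPair.snd R M N k x = x.2 :=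
  rfl

variable {n : ℕ} {M N : Type u} [TopologicalSpace M] [ChartedSpace (EuclideanSpace ℝ (Fin n)) M]
  [TopologicalSpace N] [ChartedSpace (EuclideanSpace ℝ (Fin n)) N]

/-- Restriction of classes of a cobordism `W` from `M` to `N` to its two ends, reduced modulo
torsion: `Hᵏ(W; R) → Hᵏ(M; R)/T ⊕ Hᵏ(N; R)/T`, `a ↦ ([inl^* a], [inr^* a])`.  This is Thom's
`f^* : Hᵖ(M) → Hᵖ(V)` for the boundary inclusion `f : V = ∂W → W` (Thom, Ann. Sci. ENS 69
(1952), Ch. V §II, p. 173), followed by reduction modulo torsion so that it lands where the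
integral intersection forms `Literature.AlgebraicTopology.SingularHomology.intersectionForm` live. [cite: Thom1952, Ch. V §II p. 173] -/
def Cobordism.boundaryRestrict (c : Cobordism n M N) (k : ℕ) :
    ↥(Literature.AlgebraicTopology.SingularHomology.singularCohomology R R c.W k) →ₗ[R] ↥(freeCohomologyPair R M N k) :=
  LinearMap.prod
    (Literature.AlgebraicTopology.SingularHomology.freeCohomology.mk ∘ₗ
      (Literature.AlgebraicTopology.SingularHomology.singularCohomology.map R R (ContinuousMap.mk c.inl c.continuous_inl) k).hom)
    (Literature.AlgebraicTopology.SingularHomology.freeCohomology.mk ∘ₗ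
      (Literature.AlgebraicTopology.SingularHomology.singularCohomology.map R R (ContinuousMap.mk c.inr c.continuous_inr) k).hom)

/-- **Thom's `Aᵏ`.**  For a cobordism `W` from `M` to `N`, the submodule
`Aᵏ ⊆ Hᵏ(M; R)/T ⊕ Hᵏ(N; R)/T` of restrictions of classes of `W`: the image of
`Cobordism.boundaryRestrict`.  Thom, Ann. Sci. ENS 69 (1952), Ch. V §II, p. 173: "par `A` (`Aᵖ`
pour les éléments de degré `p`) l'image de l'homomorphisme `f^*`", `f : V = ∂M → M`; here
reduced modulo torsion. [cite: Thom1952, Ch. V §II p. 173] -/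
def Cobordism.boundaryImage (c : Cobordism n M N) (k : ℕ) :
    Submodule R ↥(freeCohomologyPair R M N k) :=
  LinearMap.range (c.boundaryRestrict R k)

/-- **Thom's `r_k`.**  The rank of `Aᵏ` (Thom 1952, Ch. V §II, p. 173: "Désignons par `r_p` le
rang de `Aᵖ`"), as the `finrank` over `R` of `Cobordism.boundaryImage` (meaningful for `R` a
field or `ℤ`, where `Aᵏ` is a submodule of a finitely generated module).
[cite: Thom1952, Ch. V §II p. 173] -/
def Cobordism.boundaryImageRank (c : Cobordism n M N) (k : ℕ) : ℕ :=
  Module.finrank R ↥(c.boundaryImage R k)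

/-- The first component of the restriction map: `fst (boundaryRestrict a) = [inl^* a]`
(Thom 1952, Ch. V §II p. 173; unfolding lemma). [cite: Thom1952, Ch. V §II p. 173] -/
@[simp]
theorem Cobordism.fst_boundaryRestrict (c : Cobordism n M N) (k : ℕ)
    (a : ↥(Literature.AlgebraicTopology.SingularHomology.singularCohomology R R c.W k)) :
    freeCohomologyPair.fst R M N k (c.boundaryRestrict R k a) =
      Literature.AlgebraicTopology.SingularHomology.freeCohomology.mk
        (Literature.AlgebraicTopology.SingularHomology.singularCohomology.map R R (ContinuousMap.mk c.inl c.continuous_inl) k a) :=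
  rfl

/-- The second component of the restriction map: `snd (boundaryRestrict a) = [inr^* a]`
(Thom 1952, Ch. V §II p. 173; unfolding lemma). [cite: Thom1952, Ch. V §II p. 173] -/
@[simp]
theorem Cobordism.snd_boundaryRestrict (c : Cobordism n M N) (k : ℕ)
    (a : ↥(Literature.AlgebraicTopology.SingularHomology.singularCohomology R R c.W k)) :
    freeCohomologyPair.snd R M N k (c.boundaryRestrict R k a) =
      Literature.AlgebraicTopology.SingularHomology.freeCohomology.mk
        (Literature.AlgebraicTopology.SingularHomology.singularCohomology.map R R (ContinuousMap.mk c.inr c.continuous_inr) k a) :=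
  rfl

/-- Membership in `Aᵏ`: `x ∈ Aᵏ` iff `x = ([inl^* a], [inr^* a])` for some `a ∈ Hᵏ(W; R)`
(Thom 1952, Ch. V §II, p. 173; unfolding lemma). [cite: Thom1952, Ch. V §II p. 173] -/
theorem Cobordism.mem_boundaryImage_iff (c : Cobordism n M N) (k : ℕ)
    (x : ↥(freeCohomologyPair R M N k)) :
    x ∈ c.boundaryImage R k ↔
      ∃ a : ↥(Literature.AlgebraicTopology.SingularHomology.singularCohomology R R c.W k), c.boundaryRestrict R k a = x :=
  LinearMap.mem_range

/-- Unfolding `Cobordism.boundaryImageRank = finrank Aᵏ` (Thom 1952, Ch. V §II, p. 173).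
[cite: Thom1952, Ch. V §II p. 173] -/
theorem Cobordism.boundaryImageRank_eq (c : Cobordism n M N) (k : ℕ) :
    c.boundaryImageRank R k = Module.finrank R ↥(c.boundaryImage R k) :=
  rfl

/-- With an empty (more generally, cohomologically trivial in degree `k`) second end `N`,
`Aᵏ ⊆ Hᵏ(M; R)/T ⊕ 0` projects isomorphically onto its first component, so the projection has
rank `r_k` (Thom 1952, Ch. V §II p. 173; bookkeeping for the one-ended "variété-bord" case of
p. 175).  Stated for a general coefficient ring so that the `R`-module structures involved are
the generic ones. [cite: Thom1952, Ch. V §II p. 173] -/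
theorem Cobordism.finrank_map_fst_boundaryImage (c : Cobordism n M N) (k : ℕ)
    [Subsingleton ↥(Literature.AlgebraicTopology.SingularHomology.freeCohomology R N k)] :
    Module.finrank R ↥((c.boundaryImage R k).map (freeCohomologyPair.fst R M N k)) =
      c.boundaryImageRank R k := by
  have hinj : Function.Injective (freeCohomologyPair.fst R M N k) :=
    fun x y hxy => Prod.ext hxy (Subsingleton.elim _ _)
  exact ((Submodule.equivMapOfInjective _ hinj (c.boundaryImage R k)).finrank_eq).symm

end Pair

/-! ### `A²` is totally isotropic for the form of the oriented boundary (Thm V.7, easy half) -/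

section Isotropy

variable {n k : ℕ} {M N : Type u} [TopologicalSpace M] [ChartedSpace (EuclideanSpace ℝ (Fin n)) M]
  [TopologicalSpace N] [ChartedSpace (EuclideanSpace ℝ (Fin n)) N]

/-- **`(inl)_*[M]_μ = (inr)_*[N]_ν` in `Hₙ(W; ℤ)`** for an oriented cobordism in the homological
sense: if `∂w = (inl)_*[M]_μ − (inr)_*[N]_ν` in `Hₙ(∂W; ℤ)` for some `w ∈ H_{n+1}(W, ∂W; ℤ)`,
then pushing forward along `i : ∂W → W` kills the left-hand side, because `i_* ∘ ∂ = 0` in the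
exact sequence of the pair `(W, ∂W)` (Hatcher, *Algebraic Topology* (2002), §2.1, Thm 2.16;
`Literature.AlgebraicTopology.SingularHomology.relativeSingularHomology.δ_comp_map`).  Classically: the two ends of an oriented cobordism
are homologous in `W` (Thom 1954, Ch. IV §1).  PROVED. [cite: Hatcher2002, §2.1 Thm 2.16] -/
theorem Cobordism.map_inl_fundamentalClass_eq (c : Cobordism n M N)
    (μ : Literature.AlgebraicTopology.SingularHomology.HomologicalOrientation ℤ M n) (ν : Literature.AlgebraicTopology.SingularHomology.HomologicalOrientation ℤ N n)
    (w : ↥(Literature.AlgebraicTopology.SingularHomology.relativeSingularHomology ℤ ℤ c.W ((𝓡∂ (n + 1)).boundary c.W) (n + 1)))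
    (hw : Literature.AlgebraicTopology.SingularHomology.relativeSingularHomology.δ ℤ ℤ c.W ((𝓡∂ (n + 1)).boundary c.W) n w =
      Literature.AlgebraicTopology.SingularHomology.singularHomology.map ℤ ℤ c.inlBoundary n μ.fundamentalClass -
        Literature.AlgebraicTopology.SingularHomology.singularHomology.map ℤ ℤ c.inrBoundary n ν.fundamentalClass) :
    Literature.AlgebraicTopology.SingularHomology.singularHomology.map ℤ ℤ (ContinuousMap.mk c.inl c.continuous_inl) n μ.fundamentalClass =
      Literature.AlgebraicTopology.SingularHomology.singularHomology.map ℤ ℤ (ContinuousMap.mk c.inr c.continuous_inr) n ν.fundamentalClass := by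
  set ι : C(↥((𝓡∂ (n + 1)).boundary c.W), c.W) := ⟨Subtype.val, continuous_subtype_val⟩
  have h0 : Literature.AlgebraicTopology.SingularHomology.singularHomology.map ℤ ℤ ι n
      (Literature.AlgebraicTopology.SingularHomology.relativeSingularHomology.δ ℤ ℤ c.W ((𝓡∂ (n + 1)).boundary c.W) n w) = 0 := by
    rw [← ModuleCat.comp_apply, Literature.AlgebraicTopology.SingularHomology.relativeSingularHomology.δ_comp_map]
    rfl
  rw [hw, map_sub, sub_eq_zero, ← ModuleCat.comp_apply, ← ModuleCat.comp_apply,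
    ← Literature.AlgebraicTopology.SingularHomology.singularHomology.map_comp, ← Literature.AlgebraicTopology.SingularHomology.singularHomology.map_comp] at h0
  exact h0

/-- **`A²` is totally isotropic** (Thom, Ann. Sci. ENS 69 (1952), Thm V.7, p. 173: "des deux
espaces vectoriels `Aᵖ` et `A^{n−p}`, chacun d'eux est, pour le cup-produit, l'annulateur de
l'autre" — the inclusion `Aᵖ ∪ A^{n−p} ↦ 0`, here `n = 2k`, `p = k`).  For a cobordism `W` from
`M` to `N`, `ℤ`-orientations `μ`, `ν` and a relative class `w` with
`∂w = (inl)_*[M]_μ − (inr)_*[N]_ν` (so that the boundary `∂W ≅ M ⊔ N` is oriented by `μ ⊔ (−ν)`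
and its cup-product form on `Hᵏ(∂W)/T = Hᵏ(M)/T ⊕ Hᵏ(N)/T` is `Q_μ ⊕ (−Q_ν)`): **for
`x, y ∈ Aᵏ`, `Q_μ(x₁, y₁) = Q_ν(x₂, y₂)`**, i.e. `(Q_μ ⊕ (−Q_ν))(x, y) = 0`.  Indeed for
`x = i^*a`, `y = i^*b`: `⟨inl^*a ⌣ inl^*b, [M]_μ⟩ − ⟨inr^*a ⌣ inr^*b, [N]_ν⟩ =
⟨a ⌣ b, (inl)_*[M]_μ − (inr)_*[N]_ν⟩ = ⟨a ⌣ b, i_* ∂w⟩ = 0` by naturality of `⌣`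
(Hatcher Prop. 3.10) and of the Kronecker pairing (Hatcher §3.1 p. 201) and `i_* ∘ ∂ = 0`.
PROVED; integral coefficients, no orientability or finiteness hypothesis on `W` is needed for
this half of Thm V.7. [cite: Thom1952, Thm V.7 (p. 173)] -/
theorem Cobordism.intersectionForm_eq_of_mem_boundaryImage (h : k + k = n) (c : Cobordism n M N)
    (μ : Literature.AlgebraicTopology.SingularHomology.HomologicalOrientation ℤ M n) (ν : Literature.AlgebraicTopology.SingularHomology.HomologicalOrientation ℤ N n)
    (w : ↥(Literature.AlgebraicTopology.SingularHomology.relativeSingularHomology ℤ ℤ c.W ((𝓡∂ (n + 1)).boundary c.W) (n + 1)))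
    (hw : Literature.AlgebraicTopology.SingularHomology.relativeSingularHomology.δ ℤ ℤ c.W ((𝓡∂ (n + 1)).boundary c.W) n w =
      Literature.AlgebraicTopology.SingularHomology.singularHomology.map ℤ ℤ c.inlBoundary n μ.fundamentalClass -
        Literature.AlgebraicTopology.SingularHomology.singularHomology.map ℤ ℤ c.inrBoundary n ν.fundamentalClass)
    {x y : ↥(freeCohomologyPair ℤ M N k)} (hx : x ∈ c.boundaryImage ℤ k)
    (hy : y ∈ c.boundaryImage ℤ k) :
    Literature.AlgebraicTopology.SingularHomology.intersectionForm h μ (freeCohomologyPair.fst ℤ M N k x) (freeCohomologyPair.fst ℤ M N k y) =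
      Literature.AlgebraicTopology.SingularHomology.intersectionForm h ν (freeCohomologyPair.snd ℤ M N k x)
        (freeCohomologyPair.snd ℤ M N k y) := by
  obtain ⟨a, rfl⟩ := hx
  obtain ⟨b, rfl⟩ := hy
  simp only [Cobordism.fst_boundaryRestrict, Cobordism.snd_boundaryRestrict, Literature.AlgebraicTopology.SingularHomology.intersectionForm_mk_mk,
    Literature.AlgebraicTopology.SingularHomology.cupPairing_apply, ← Literature.AlgebraicTopology.SingularHomology.cupProduct_map, Literature.AlgebraicTopology.SingularHomology.kroneckerPairing_map]
  rw [c.map_inl_fundamentalClass_eq μ ν w hw]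

/-- The quadratic form of `Q_μ ⊕ (−Q_ν)` vanishes on `Aᵏ`: `Q_μ(x₁, x₁) = Q_ν(x₂, x₂)` for
`x ∈ Aᵏ` (Thom 1952, p. 176: "Si `V` est une variété-bord, on a `Φ(x, x) = 0` pour toute classe
`x ∈ A^{2k}`"; the diagonal of `Cobordism.intersectionForm_eq_of_mem_boundaryImage`).  PROVED.
[cite: Thom1952, Thm V.10 (p. 176)] -/
theorem Cobordism.intersectionForm_self_eq_of_mem_boundaryImage (h : k + k = n)
    (c : Cobordism n M N) (μ : Literature.AlgebraicTopology.SingularHomology.HomologicalOrientation ℤ M n) (ν : Literature.AlgebraicTopology.SingularHomology.HomologicalOrientation ℤ N n)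
    (w : ↥(Literature.AlgebraicTopology.SingularHomology.relativeSingularHomology ℤ ℤ c.W ((𝓡∂ (n + 1)).boundary c.W) (n + 1)))
    (hw : Literature.AlgebraicTopology.SingularHomology.relativeSingularHomology.δ ℤ ℤ c.W ((𝓡∂ (n + 1)).boundary c.W) n w =
      Literature.AlgebraicTopology.SingularHomology.singularHomology.map ℤ ℤ c.inlBoundary n μ.fundamentalClass -
        Literature.AlgebraicTopology.SingularHomology.singularHomology.map ℤ ℤ c.inrBoundary n ν.fundamentalClass)
    {x : ↥(freeCohomologyPair ℤ M N k)} (hx : x ∈ c.boundaryImage ℤ k) :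
    Literature.AlgebraicTopology.SingularHomology.intersectionForm h μ (freeCohomologyPair.fst ℤ M N k x) (freeCohomologyPair.fst ℤ M N k x) =
      Literature.AlgebraicTopology.SingularHomology.intersectionForm h ν (freeCohomologyPair.snd ℤ M N k x)
        (freeCohomologyPair.snd ℤ M N k x) :=
  c.intersectionForm_eq_of_mem_boundaryImage h μ ν w hw hx hx

end Isotropy

end Literature.Topology.FourManifolds

namespace Literature.Topology.FourManifolds

/-! ### Inside Thm IV.1: Thom (1952) Cor. V.8 as the Poincaré–Lefschetz leaf, and V.8 ⟹ IV.1 -/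

/-- **Thom (1952), Cor. V.8, for the boundary of a compact oriented 5-manifold in middle degree**
(Ann. Sci. ENS 69, p. 173): for `V` orientable bounding `M` compact orientable, field
coefficients, `Aᵖ = f^* Hᵖ(M) ⊂ Hᵖ(V)` of rank `r_p`, "Entre les rangs de `Aᵖ` et `A^{n−p}` on a
la relation : `r_p + r_{n−p} = b_p(V) = b_{n−p}(V)`" — a corollary of Thm V.7 (`Aᵖ` and `A^{n−p}`
are each other's annihilator), deduced there from the duality theorem for manifolds with
boundary, Thm V.4–Cor. V.5 (Poincaré–Lefschetz).  Vendored
for `n = 4`, `p = 2`, `V = ∂W ≅ M ⊔ N` the boundary of a cobordism between closed smooth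
4-manifolds in the setting of `isOrientedBordant_iff_signature_eq`, with orientability of `W`
expressed, as everywhere in this file, by a relative class `w ∈ H₅(W, ∂W; ℤ)` with
`∂w = (inl)_*[M]_μ − (inr)_*[N]_ν` (the components of `W` meeting `∂W` are then `ℤ`-orientable,
and the others do not contribute to `A²`), and transcribed from field coefficients to the lattice
`H²(M; ℤ)/T ⊕ H²(N; ℤ)/T` (for compact manifolds `rank_ℤ` of the image modulo torsion equals
`dim_ℚ` of the rational image, and `rank_ℤ H²(−; ℤ)/T = b₂`, by universal coefficients):
**`2 · r₂ = b₂(M) + b₂(N)`, i.e.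
`2 * c.boundaryImageRank ℤ 2 = rank H²(M; ℤ)/T + rank H²(N; ℤ)/T`.**  Together with the proved
isotropy of `A²` (`Cobordism.intersectionForm_eq_of_mem_boundaryImage`) this says that `A²` is a
Lagrangian of `Q_μ ⊕ (−Q_ν)`; it is the only input from duality with boundary in the proof of
Thm IV.1 below, and it is absent from Mathlib and `Literature`.
[cite: Thom1952, Cor. V.8 (p. 173)] -/
def two_mul_boundaryImageRank_eq : Prop :=
  ∀ {M N : Type u} [TopologicalSpace M] [T2Space M] [SecondCountableTopology M]
    [ChartedSpace (EuclideanSpace ℝ (Fin 4)) M] [CompactSpace M] [IsManifold (𝓡 4) ∞ M]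
    [TopologicalSpace N] [T2Space N] [SecondCountableTopology N]
    [ChartedSpace (EuclideanSpace ℝ (Fin 4)) N] [CompactSpace N] [IsManifold (𝓡 4) ∞ N]
    (μ : Literature.AlgebraicTopology.SingularHomology.HomologicalOrientation ℤ M 4) (ν : Literature.AlgebraicTopology.SingularHomology.HomologicalOrientation ℤ N 4) (c : Cobordism 4 M N)
    (w : ↥(Literature.AlgebraicTopology.SingularHomology.relativeSingularHomology ℤ ℤ c.W ((𝓡∂ (4 + 1)).boundary c.W) (4 + 1)))
    (_hw : Literature.AlgebraicTopology.SingularHomology.relativeSingularHomology.δ ℤ ℤ c.W ((𝓡∂ (4 + 1)).boundary c.W) 4 w =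
      Literature.AlgebraicTopology.SingularHomology.singularHomology.map ℤ ℤ c.inlBoundary 4 μ.fundamentalClass -
        Literature.AlgebraicTopology.SingularHomology.singularHomology.map ℤ ℤ c.inrBoundary 4 ν.fundamentalClass),
    2 * c.boundaryImageRank ℤ 2 =
      Module.finrank ℤ ↥(Literature.AlgebraicTopology.SingularHomology.freeCohomology ℤ M 2) + Module.finrank ℤ ↥(Literature.AlgebraicTopology.SingularHomology.freeCohomology ℤ N 2)

/-- **Cor. V.8 ⟹ Thm IV.1** (Thom 1954, Ch. IV §2, p. 65, via Thom 1952, pp. 173–176, applied to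
the whole boundary `∂W = M ⊔ N̄`).  Given the rank statement `two_mul_boundaryImageRank_eq`
(Cor. V.8), the signature split `b₂⁺ + b₂⁻ = b₂` for closed oriented 4-manifolds
(`Literature.AlgebraicTopology.SingularHomology.sigPos_add_sigNeg_intersectionForm`, Sylvester; a named fact of
`Literature.AlgebraicTopology.SingularHomology.IntersectionForm`, hypothesis `hS`) and finite
generation of `H²(−; ℤ)` (`Literature.AlgebraicTopology.SingularHomology.finite_singularCohomology_of_compactSpace`, `…PoincareDuality`,
hypothesis `hF`), **oriented bordant closed smooth 4-manifolds have equal signature**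
(`signature_eq_of_isOrientedBordant`, Thm IV.1 for `k = 1`): `A²` is isotropic for
`Q_μ ⊕ (−Q_ν)` (proved) of half rank (V.8), so `b⁺(Q_μ) − b⁻(Q_μ) = b⁺(Q_ν) − b⁻(Q_ν)` by
`Literature.Topology.FourManifolds.sigPos_add_sigNeg_eq_of_graph` (Thom's `Inf(p, b − p)` argument, p. 176).  PROVED.
[cite: ThomCMH1954, Thm IV.1 (p. 65), via Thom1952 Cor. V.8 and p. 176] -/
theorem signature_eq_of_isOrientedBordant_of_boundaryImageRank
    (hT : two_mul_boundaryImageRank_eq.{u})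
    (hS : ∀ {P : Type u} [TopologicalSpace P] [T2Space P] [CompactSpace P]
      [ChartedSpace (EuclideanSpace ℝ (Fin 4)) P] (π : Literature.AlgebraicTopology.SingularHomology.HomologicalOrientation ℤ P 4),
      Literature.AlgebraicTopology.SingularHomology.sigPos_add_sigNeg_intersectionForm even_two two_add_two_eq_four π)
    (hF : ∀ {P : Type u} [TopologicalSpace P] [T2Space P] [CompactSpace P]
      [ChartedSpace (EuclideanSpace ℝ (Fin 4)) P],
      Literature.AlgebraicTopology.SingularHomology.finite_singularCohomology_of_compactSpace ℤ P 4 2) :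
    signature_eq_of_isOrientedBordant.{u} := by
  intro M N _ _ _ _ _ _ _ _ _ _ _ _ μ ν hb
  obtain ⟨c, w, hw⟩ := hb
  haveI : Module.Finite ℤ ↥(Literature.AlgebraicTopology.SingularHomology.freeCohomology ℤ M 2) := Literature.AlgebraicTopology.SingularHomology.finite_freeCohomology hF
  haveI : Module.Finite ℤ ↥(Literature.AlgebraicTopology.SingularHomology.freeCohomology ℤ N 2) := Literature.AlgebraicTopology.SingularHomology.finite_freeCohomology hF
  have h := Literature.Topology.FourManifolds.sigPos_add_sigNeg_eq_of_graph
    (Literature.AlgebraicTopology.SingularHomology.intersectionForm two_add_two_eq_four μ).toQuadraticMap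
    (Literature.AlgebraicTopology.SingularHomology.intersectionForm two_add_two_eq_four ν).toQuadraticMap (B := c.boundaryImage ℤ 2)
    (fun x hx => by
      simpa using c.intersectionForm_self_eq_of_mem_boundaryImage two_add_two_eq_four μ ν w hw hx)
    (hT μ ν c w hw) (hS μ) (hS ν)
  simp only [Literature.AlgebraicTopology.SingularHomology.HomologicalOrientation.signature, LinearMap.BilinForm.signature]
  omega

/-- **spc4.S36 from the leaves.**  `isOrientedBordant_iff_signature_eq` follows from Thom (1952)
Cor. V.8 in dimension four (`two_mul_boundaryImageRank_eq`), Sylvester's `b₂⁺ + b₂⁻ = b₂` and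
finiteness of `H²` for closed 4-manifolds (standing named facts, hypotheses `hS`, `hF`), and the
injectivity half of Thom (1954) Thm IV.13 (`isOrientedBordant_of_signature_eq`).  PROVED
(assembly: V.8 ⟹ IV.1, then IV.1 ∧ IV.13 ⟹ S36). [cite: ThomCMH1954, Thm IV.1 and Thm IV.13] -/
theorem isOrientedBordant_iff_signature_eq_of_boundaryImageRank
    (hT : two_mul_boundaryImageRank_eq.{u})
    (hS : ∀ {P : Type u} [TopologicalSpace P] [T2Space P] [CompactSpace P]
      [ChartedSpace (EuclideanSpace ℝ (Fin 4)) P] (π : Literature.AlgebraicTopology.SingularHomology.HomologicalOrientation ℤ P 4),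
      Literature.AlgebraicTopology.SingularHomology.sigPos_add_sigNeg_intersectionForm even_two two_add_two_eq_four π)
    (hF : ∀ {P : Type u} [TopologicalSpace P] [T2Space P] [CompactSpace P]
      [ChartedSpace (EuclideanSpace ℝ (Fin 4)) P],
      Literature.AlgebraicTopology.SingularHomology.finite_singularCohomology_of_compactSpace ℤ P 4 2)
    (h₂ : isOrientedBordant_of_signature_eq.{u}) : isOrientedBordant_iff_signature_eq.{u} :=
  isOrientedBordant_iff_signature_eq_of
    (signature_eq_of_isOrientedBordant_of_boundaryImageRank hT hS hF) h₂

/-! ### The one-ended case printed by Thom: Thm V.10 and Cor. V.11 in dimension four -/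

/-- **Thom (1952), Thm V.10, in dimension four** (Ann. Sci. ENS 69, p. 176): "Pour qu'une variété
orientée de dimension `4k` soit une variété-bord, il faut que la forme quadratique définie par le
cup-produit sur `H^{2k}` admette pour indice d'inertie `½ b^{2k}(V)`", the *indice d'inertie*
being "le rang maximum des sous-espaces linéaires contenus dans le cône `Φ(x, x) = 0`" (field
coefficients).  Vendored for `k = 1` in the setting of `isOrientedBordant_iff_signature_eq`, on
the lattice `H²(P; ℤ)/T` (equivalent to the rational statement by universal coefficients) and
in its existence form, which is the content of the theorem (Thom's witness is `A² = i^*H²(W)`,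
by Thm V.7 and Cor. V.8): **if `(P, π)` is a closed smooth `ℤ`-oriented 4-manifold which is an
oriented boundary (`IsOrientedBordant 4 π ν` with `N` empty, Thom's "variété-bord", p. 175),
then `H²(P; ℤ)/T` contains a submodule `K` of half rank on which `x ↦ Q_P(x, x)` vanishes
identically.**  Proved below from Cor. V.8 (`exists_isotropic_of_isOrientedBordant_of_isEmpty_of`).
[cite: Thom1952, Thm V.10 (p. 176)] -/
def exists_isotropic_of_isOrientedBordant_of_isEmpty : Prop :=
  ∀ {P N : Type u} [TopologicalSpace P] [T2Space P] [SecondCountableTopology P]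
    [ChartedSpace (EuclideanSpace ℝ (Fin 4)) P] [CompactSpace P] [IsManifold (𝓡 4) ∞ P]
    [TopologicalSpace N] [T2Space N] [SecondCountableTopology N]
    [ChartedSpace (EuclideanSpace ℝ (Fin 4)) N] [CompactSpace N] [IsManifold (𝓡 4) ∞ N] [IsEmpty N]
    (π : Literature.AlgebraicTopology.SingularHomology.HomologicalOrientation ℤ P 4) (ν : Literature.AlgebraicTopology.SingularHomology.HomologicalOrientation ℤ N 4),
    IsOrientedBordant 4 π ν →
      ∃ K : Submodule ℤ ↥(Literature.AlgebraicTopology.SingularHomology.freeCohomology ℤ P 2),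
        (∀ x ∈ K, Literature.AlgebraicTopology.SingularHomology.intersectionForm two_add_two_eq_four π x x = 0) ∧
          2 * Module.finrank ℤ ↥K = Module.finrank ℤ ↥(Literature.AlgebraicTopology.SingularHomology.freeCohomology ℤ P 2)

/-- **Cor. V.8 (+ the proved half of Thm V.7) ⟹ Thm V.10** (Thom 1952, p. 176: "Si `V` est une
variété-bord, on a `Φ(x, x) = 0` pour toute classe `x ∈ A^{2k}`; or d'après le théorème V.8, le
rang de `A^{2k}` est égal à `½ b^{2k}(V)`").  With an empty second end `N`, `H²(N; ℤ)/T = 0`, so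
`A² ⊆ H²(P; ℤ)/T ⊕ 0` projects isomorphically onto its first component `K`, which is isotropic
for `Q_π` (`Cobordism.intersectionForm_self_eq_of_mem_boundaryImage`) of rank `r₂ = ½ b₂(P)`
(`two_mul_boundaryImageRank_eq`).  PROVED. [cite: Thom1952, Thm V.10 (p. 176)] -/
theorem exists_isotropic_of_isOrientedBordant_of_isEmpty_of
    (hT : two_mul_boundaryImageRank_eq.{u}) :
    exists_isotropic_of_isOrientedBordant_of_isEmpty.{u} := by
  intro P N _ _ _ _ _ _ _ _ _ _ _ _ _ π ν hb
  obtain ⟨c, w, hw⟩ := hb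
  refine ⟨(c.boundaryImage ℤ 2).map (freeCohomologyPair.fst ℤ P N 2), ?_, ?_⟩
  · rintro _ ⟨x, hx, rfl⟩
    rw [c.intersectionForm_self_eq_of_mem_boundaryImage two_add_two_eq_four π ν w hw hx,
      Subsingleton.elim (freeCohomologyPair.snd ℤ P N 2 x) 0, map_zero]
  · have h1 := hT π ν c w hw
    rw [← c.finrank_map_fst_boundaryImage ℤ 2,
      Module.finrank_zero_of_subsingleton (R := ℤ) (M := ↥(Literature.AlgebraicTopology.SingularHomology.freeCohomology ℤ N 2)),
      add_zero] at h1
    convert h1 using 4 <;> first | rfl | exact Subsingleton.elim _ _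

/-- **Thm V.10 ⟹ Cor. V.11 in dimension four** (Thom 1952, p. 176: over `ℝ` or `ℚ` "l'indice
d'inertie est égal à `Inf(p, b₂ − p)`", so an isotropic half forces `p = b₂/2` and
`τ = p − (b₂ − p) = 0`).  PROVED from the algebra
`LinearMap.BilinForm.signature_eq_zero_of_isotropic`, relative to the two standing named facts
`Literature.AlgebraicTopology.SingularHomology.sigPos_add_sigNeg_intersectionForm` (`b₂⁺ + b₂⁻ = b₂`) and
`Literature.AlgebraicTopology.SingularHomology.finite_singularCohomology_of_compactSpace` (`H²(P; ℤ)` finitely generated), taken as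
hypotheses. [cite: Thom1952, Cor. V.11 (p. 176)] -/
theorem signature_eq_zero_of_isOrientedBordant_of_isEmpty_of_exists_isotropic
    (hT : exists_isotropic_of_isOrientedBordant_of_isEmpty.{u})
    (hS : ∀ {P : Type u} [TopologicalSpace P] [T2Space P] [CompactSpace P]
      [ChartedSpace (EuclideanSpace ℝ (Fin 4)) P] (π : Literature.AlgebraicTopology.SingularHomology.HomologicalOrientation ℤ P 4),
      Literature.AlgebraicTopology.SingularHomology.sigPos_add_sigNeg_intersectionForm even_two two_add_two_eq_four π)
    (hF : ∀ {P : Type u} [TopologicalSpace P] [T2Space P] [CompactSpace P]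
      [ChartedSpace (EuclideanSpace ℝ (Fin 4)) P],
      Literature.AlgebraicTopology.SingularHomology.finite_singularCohomology_of_compactSpace ℤ P 4 2) :
    signature_eq_zero_of_isOrientedBordant_of_isEmpty.{u} := by
  intro P N _ _ _ _ _ _ _ _ _ _ _ _ _ π ν hb
  obtain ⟨K, hK, h2⟩ := hT π ν hb
  haveI : Module.Finite ℤ ↥(Literature.AlgebraicTopology.SingularHomology.freeCohomology ℤ P 2) := Literature.AlgebraicTopology.SingularHomology.finite_freeCohomology hF
  exact LinearMap.BilinForm.signature_eq_zero_of_isotropic _ hK h2 (hS π)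

/-- **Cor. V.11 from Cor. V.8** (composition of the two previous reductions): the rank statement
`two_mul_boundaryImageRank_eq`, Sylvester over `ℤ` and finiteness of `H²(P; ℤ)` give
`σ(P, π) = 0` for every oriented boundary `(P, π)` (Thom 1952, p. 176).  PROVED.  (Equivalently:
through Thm IV.1, `signature_eq_of_isOrientedBordant_of_boundaryImageRank` and
`signature_eq_zero_of_isOrientedBordant_of_isEmpty_of`.) [cite: Thom1952, Cor. V.11 (p. 176)] -/
theorem signature_eq_zero_of_isOrientedBordant_of_isEmpty_of_boundaryImageRank
    (hT : two_mul_boundaryImageRank_eq.{u})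
    (hS : ∀ {P : Type u} [TopologicalSpace P] [T2Space P] [CompactSpace P]
      [ChartedSpace (EuclideanSpace ℝ (Fin 4)) P] (π : Literature.AlgebraicTopology.SingularHomology.HomologicalOrientation ℤ P 4),
      Literature.AlgebraicTopology.SingularHomology.sigPos_add_sigNeg_intersectionForm even_two two_add_two_eq_four π)
    (hF : ∀ {P : Type u} [TopologicalSpace P] [T2Space P] [CompactSpace P]
      [ChartedSpace (EuclideanSpace ℝ (Fin 4)) P],
      Literature.AlgebraicTopology.SingularHomology.finite_singularCohomology_of_compactSpace ℤ P 4 2) :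
    signature_eq_zero_of_isOrientedBordant_of_isEmpty.{u} :=
  signature_eq_zero_of_isOrientedBordant_of_isEmpty_of_exists_isotropic
    (exists_isotropic_of_isOrientedBordant_of_isEmpty_of hT) hS hF

/-! ### The classical form of the injectivity of `τ` (Kirby 1989, Cor. IX.2) -/

/-- **A closed oriented smooth 4-manifold of signature zero bounds** (Kirby, LNM 1374 (1989),
Cor. IX.2, first sentence of the proof: "if `σ(M) = 0`, then `M` bounds an oriented 5-manifold",
via VIII Thm 1(A) (`M⁴` closed smooth connected orientable with `p₁(M) = index(M) = 0` bounds a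
smooth `W⁵`) and the signature theorem IX Thm 1, `p₁(M) = 3σ(M)`; equivalently the kernel of
`τ : Ω⁴ → ℤ` is trivial, Thom, Comment. Math. Helv. 28 (1954), Thm IV.13 with Ch. IV §8 p. 81).
In the setting of `isOrientedBordant_iff_signature_eq` and Thom's homological convention for
"variété-bord" (`IsOrientedBordant 4 μ ν` with `N` empty): **if `σ(M, μ) = 0` then `(M, μ)` is
an oriented boundary.**  This is `isOrientedBordant_of_signature_eq` with an empty second end
(proved edge `isOrientedBordant_of_isEmpty_of_signature_eq_zero_of`); the converse bookkeeping
(`(M, μ) ∼ (N, ν)` iff `M ⊔ N̄` bounds, and `σ(M ⊔ N̄) = σ(M) − σ(N)`) needs `ℤ`-orientations of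
disjoint unions, not in `Literature`, and is not vendored.
[cite: Kirby1989, Cor. IX.2 with VIII Thm 1(A) and IX Thm 1] -/
def isOrientedBordant_of_isEmpty_of_signature_eq_zero : Prop :=
  ∀ {M N : Type u} [TopologicalSpace M] [T2Space M] [SecondCountableTopology M]
    [ChartedSpace (EuclideanSpace ℝ (Fin 4)) M] [CompactSpace M] [IsManifold (𝓡 4) ∞ M]
    [TopologicalSpace N] [T2Space N] [SecondCountableTopology N]
    [ChartedSpace (EuclideanSpace ℝ (Fin 4)) N] [CompactSpace N] [IsManifold (𝓡 4) ∞ N] [IsEmpty N]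
    (μ : Literature.AlgebraicTopology.SingularHomology.HomologicalOrientation ℤ M 4) (ν : Literature.AlgebraicTopology.SingularHomology.HomologicalOrientation ℤ N 4),
    μ.signature = 0 → IsOrientedBordant 4 μ ν

/-- **Thm IV.13 (injectivity of `τ`) ⟹ the null-bordism form**: if equal signatures imply
oriented bordism, then a signature-zero manifold is bordant to the empty manifold, whose
signature is `0` (`HomologicalOrientation.signature_eq_zero_of_isEmpty`).  PROVED (Kirby 1989,
Cor. IX.2). [cite: Kirby1989, Cor. IX.2] -/
theorem isOrientedBordant_of_isEmpty_of_signature_eq_zero_of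
    (h : isOrientedBordant_of_signature_eq.{u}) :
    isOrientedBordant_of_isEmpty_of_signature_eq_zero.{u} := by
  intro M N _ _ _ _ _ _ _ _ _ _ _ _ _ μ ν hσ
  exact h μ ν (by rw [hσ, Literature.AlgebraicTopology.SingularHomology.HomologicalOrientation.signature_eq_zero_of_isEmpty])

/-- In particular the full statement `isOrientedBordant_iff_signature_eq` contains the
null-bordism form (Kirby 1989, Cor. IX.2; Thom 1954, Thm IV.13).  PROVED.
[cite: Kirby1989, Cor. IX.2] -/
theorem isOrientedBordant_of_isEmpty_of_signature_eq_zero_of'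
    (h : isOrientedBordant_iff_signature_eq.{u}) :
    isOrientedBordant_of_isEmpty_of_signature_eq_zero.{u} :=
  isOrientedBordant_of_isEmpty_of_signature_eq_zero_of (isOrientedBordant_of_signature_eq_of h)

end Literature.Topology.FourManifolds


namespace Literature.Topology.FourManifolds

/-! ### Transferring additivity along a homeomorphism `X ⊕ Y ≃ₜ Z` -/

section SumHomeo

variable {R : Type v} [CommRing R] {M' : Type v} [AddCommGroup M'] [Module R M']
variable {X Y Z : Type u} [TopologicalSpace X] [TopologicalSpace Y] [TopologicalSpace Z]

/-- A continuous map `iX : X → Z` agreeing pointwise with `e ∘ inl` for a homeomorphism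
`e : X ⊕ Y ≃ₜ Z` is `e ∘ inl` as a continuous map. [folklore] -/
lemma eq_comp_sumInl_of_homeomorph (e : X ⊕ Y ≃ₜ Z) (iX : C(X, Z)) (hX : ∀ x, iX x = e (Sum.inl x)) :
    iX = (e : C(X ⊕ Y, Z)).comp (Literature.AlgebraicTopology.SingularHomology.SingularSimplex.sumInl X Y) :=
  ContinuousMap.ext hX

/-- A continuous map `iY : Y → Z` agreeing pointwise with `e ∘ inr` for a homeomorphism
`e : X ⊕ Y ≃ₜ Z` is `e ∘ inr` as a continuous map. [folklore] -/
lemma eq_comp_sumInr_of_homeomorph (e : X ⊕ Y ≃ₜ Z) (iY : C(Y, Z)) (hY : ∀ y, iY y = e (Sum.inr y)) :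
    iY = (e : C(X ⊕ Y, Z)).comp (Literature.AlgebraicTopology.SingularHomology.SingularSimplex.sumInr X Y) :=
  ContinuousMap.ext hY

/-- **Additivity of homology for an embedded disjoint union**: if `Z = iX(X) ⊔ iY(Y)` through a
homeomorphism `X ⊕ Y ≃ₜ Z`, then `iX_* a + iY_* b = 0` iff `a = 0` and `b = 0`
(Hatcher 2002, Prop. 2.6). [cite: Hatcher2002, Prop. 2.6] -/
theorem _root_.Literature.AlgebraicTopology.SingularHomology.singularHomology.map_add_map_eq_zero_iff_of_homeomorph (e : X ⊕ Y ≃ₜ Z) (iX : C(X, Z))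
    (iY : C(Y, Z)) (hX : ∀ x, iX x = e (Sum.inl x)) (hY : ∀ y, iY y = e (Sum.inr y)) (n : ℕ)
    (a : Literature.AlgebraicTopology.SingularHomology.singularHomology R M' X n) (b : Literature.AlgebraicTopology.SingularHomology.singularHomology R M' Y n) :
    Literature.AlgebraicTopology.SingularHomology.singularHomology.map R M' iX n a + Literature.AlgebraicTopology.SingularHomology.singularHomology.map R M' iY n b = 0 ↔ a = 0 ∧ b = 0 := by
  rw [eq_comp_sumInl_of_homeomorph e iX hX, eq_comp_sumInr_of_homeomorph e iY hY,
    Literature.AlgebraicTopology.SingularHomology.singularHomology.map_comp, Literature.AlgebraicTopology.SingularHomology.singularHomology.map_comp, ModuleCat.comp_apply, ModuleCat.comp_apply,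
    ← map_add]
  change (Literature.AlgebraicTopology.SingularHomology.singularHomology.mapIso R M' e n).toLinearEquiv _ = 0 ↔ _
  rw [LinearEquiv.map_eq_zero_iff, Literature.AlgebraicTopology.SingularHomology.singularHomology.map_inl_add_map_inr_eq_zero_iff]

variable (R M') in
/-- `Hₙ(X; M) × Hₙ(Y; M) ≃ₗ[R] Hₙ(Z; M)`, `(a, b) ↦ iX_* a + iY_* b`, for an embedded disjoint
union `X ⊕ Y ≃ₜ Z` (Hatcher 2002, Prop. 2.6). [cite: Hatcher2002, Prop. 2.6] -/
def _root_.Literature.AlgebraicTopology.SingularHomology.singularHomology.sumEquivOfHomeomorph (e : X ⊕ Y ≃ₜ Z) (n : ℕ) :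
    (Literature.AlgebraicTopology.SingularHomology.singularHomology R M' X n × Literature.AlgebraicTopology.SingularHomology.singularHomology R M' Y n) ≃ₗ[R] Literature.AlgebraicTopology.SingularHomology.singularHomology R M' Z n :=
  (Literature.AlgebraicTopology.SingularHomology.singularHomology.sumEquiv R M' X Y n).trans (Literature.AlgebraicTopology.SingularHomology.singularHomology.mapIso R M' e n).toLinearEquiv

/-- `sumEquivOfHomeomorph (a, b) = iX_* a + iY_* b`. [folklore] -/
lemma _root_.Literature.AlgebraicTopology.SingularHomology.singularHomology.sumEquivOfHomeomorph_apply (e : X ⊕ Y ≃ₜ Z) (iX : C(X, Z)) (iY : C(Y, Z))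
    (hX : ∀ x, iX x = e (Sum.inl x)) (hY : ∀ y, iY y = e (Sum.inr y)) (n : ℕ)
    (ab : Literature.AlgebraicTopology.SingularHomology.singularHomology R M' X n × Literature.AlgebraicTopology.SingularHomology.singularHomology R M' Y n) :
    Literature.AlgebraicTopology.SingularHomology.singularHomology.sumEquivOfHomeomorph R M' e n ab =
      Literature.AlgebraicTopology.SingularHomology.singularHomology.map R M' iX n ab.1 + Literature.AlgebraicTopology.SingularHomology.singularHomology.map R M' iY n ab.2 := by
  rw [eq_comp_sumInl_of_homeomorph e iX hX, eq_comp_sumInr_of_homeomorph e iY hY,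
    Literature.AlgebraicTopology.SingularHomology.singularHomology.map_comp, Literature.AlgebraicTopology.SingularHomology.singularHomology.map_comp, ModuleCat.comp_apply, ModuleCat.comp_apply,
    ← map_add]
  rfl

variable (R M') in
/-- `Hⁿ(Z; M) ≃ₗ[R] Hⁿ(X; M) × Hⁿ(Y; M)`, `z ↦ (iX^* z, iY^* z)`, for an embedded disjoint union
`X ⊕ Y ≃ₜ Z` (Hatcher 2002, §3.1, p. 202). [cite: Hatcher2002, §3.1 p. 202] -/
def _root_.Literature.AlgebraicTopology.SingularHomology.singularCohomology.sumEquivOfHomeomorph (e : X ⊕ Y ≃ₜ Z) (n : ℕ) :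
    Literature.AlgebraicTopology.SingularHomology.singularCohomology R M' Z n ≃ₗ[R] (Literature.AlgebraicTopology.SingularHomology.singularCohomology R M' X n × Literature.AlgebraicTopology.SingularHomology.singularCohomology R M' Y n) :=
  (Literature.AlgebraicTopology.SingularHomology.singularCohomology.mapIso R M' e n).toLinearEquiv.trans (Literature.AlgebraicTopology.SingularHomology.singularCohomology.sumEquiv R M' X Y n)

/-- `sumEquivOfHomeomorph z = (iX^* z, iY^* z)`. [folklore] -/
lemma _root_.Literature.AlgebraicTopology.SingularHomology.singularCohomology.sumEquivOfHomeomorph_apply (e : X ⊕ Y ≃ₜ Z) (iX : C(X, Z)) (iY : C(Y, Z))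
    (hX : ∀ x, iX x = e (Sum.inl x)) (hY : ∀ y, iY y = e (Sum.inr y)) (n : ℕ)
    (z : Literature.AlgebraicTopology.SingularHomology.singularCohomology R M' Z n) :
    Literature.AlgebraicTopology.SingularHomology.singularCohomology.sumEquivOfHomeomorph R M' e n z =
      (Literature.AlgebraicTopology.SingularHomology.singularCohomology.map R M' iX n z, Literature.AlgebraicTopology.SingularHomology.singularCohomology.map R M' iY n z) := by
  rw [eq_comp_sumInl_of_homeomorph e iX hX, eq_comp_sumInr_of_homeomorph e iY hY,
    Literature.AlgebraicTopology.SingularHomology.singularCohomology.map_comp, Literature.AlgebraicTopology.SingularHomology.singularCohomology.map_comp, ModuleCat.comp_apply, ModuleCat.comp_apply]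
  rfl

/-- A class of `Hⁿ(Z)` vanishes iff its restrictions to the two pieces vanish. [folklore] -/
theorem _root_.Literature.AlgebraicTopology.SingularHomology.singularCohomology.eq_zero_iff_of_homeomorph (e : X ⊕ Y ≃ₜ Z) (iX : C(X, Z)) (iY : C(Y, Z))
    (hX : ∀ x, iX x = e (Sum.inl x)) (hY : ∀ y, iY y = e (Sum.inr y)) (n : ℕ)
    (z : Literature.AlgebraicTopology.SingularHomology.singularCohomology R M' Z n) :
    z = 0 ↔ Literature.AlgebraicTopology.SingularHomology.singularCohomology.map R M' iX n z = 0 ∧ Literature.AlgebraicTopology.SingularHomology.singularCohomology.map R M' iY n z = 0 := by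
  rw [← (Literature.AlgebraicTopology.SingularHomology.singularCohomology.sumEquivOfHomeomorph R M' e n).map_eq_zero_iff,
    Literature.AlgebraicTopology.SingularHomology.singularCohomology.sumEquivOfHomeomorph_apply e iX iY hX hY, Prod.mk_eq_zero]

/-- Finite generation of `Hₙ(Z)` from that of the two pieces of `X ⊕ Y ≃ₜ Z`. [folklore] -/
theorem _root_.Literature.AlgebraicTopology.SingularHomology.singularHomology.finite_of_homeomorph (e : X ⊕ Y ≃ₜ Z) (n : ℕ)
    [Module.Finite R (Literature.AlgebraicTopology.SingularHomology.singularHomology R M' X n)] [Module.Finite R (Literature.AlgebraicTopology.SingularHomology.singularHomology R M' Y n)] :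
    Module.Finite R (Literature.AlgebraicTopology.SingularHomology.singularHomology R M' Z n) :=
  Module.Finite.equiv (Literature.AlgebraicTopology.SingularHomology.singularHomology.sumEquivOfHomeomorph R M' e n)

/-- Finite generation of `Hⁿ(Z)` from that of the two pieces of `X ⊕ Y ≃ₜ Z`. [folklore] -/
theorem _root_.Literature.AlgebraicTopology.SingularHomology.singularCohomology.finite_of_homeomorph (e : X ⊕ Y ≃ₜ Z) (n : ℕ)
    [Module.Finite R (Literature.AlgebraicTopology.SingularHomology.singularCohomology R M' X n)] [Module.Finite R (Literature.AlgebraicTopology.SingularHomology.singularCohomology R M' Y n)] :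
    Module.Finite R (Literature.AlgebraicTopology.SingularHomology.singularCohomology R M' Z n) :=
  Module.Finite.equiv (Literature.AlgebraicTopology.SingularHomology.singularCohomology.sumEquivOfHomeomorph R M' e n).symm

/-- `rank Hⁿ(Z) = rank Hⁿ(X) + rank Hⁿ(Y)` for `X ⊕ Y ≃ₜ Z` (Hatcher 2002, §3.1, p. 202). [cite: Hatcher2002, §3.1 p. 202] -/
theorem _root_.Literature.AlgebraicTopology.SingularHomology.singularCohomology.finrank_eq_add_of_homeomorph [IsDomain R] (e : X ⊕ Y ≃ₜ Z) (n : ℕ)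
    [Module.Finite R (Literature.AlgebraicTopology.SingularHomology.singularCohomology R M' X n)] [Module.Finite R (Literature.AlgebraicTopology.SingularHomology.singularCohomology R M' Y n)] :
    Module.finrank R (Literature.AlgebraicTopology.SingularHomology.singularCohomology R M' Z n) =
      Module.finrank R (Literature.AlgebraicTopology.SingularHomology.singularCohomology R M' X n) + Module.finrank R (Literature.AlgebraicTopology.SingularHomology.singularCohomology R M' Y n) := by
  rw [(Literature.AlgebraicTopology.SingularHomology.singularCohomology.sumEquivOfHomeomorph R M' e n).finrank_eq, finrank_prod_of_isDomain]

/-- `rank Hⁿ(Z; R) = rank Hₙ(Z; R)` for `X ⊕ Y ≃ₜ Z` when `Hⁿ ≅ Hₙ` on each piece (e.g. by Poincaré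
duality of closed manifolds `X`, `Y`). [folklore] -/
theorem finrank_singularCohomology_eq_finrank_singularHomology_of_homeomorph (e : X ⊕ Y ≃ₜ Z) (n : ℕ)
    (eX : Literature.AlgebraicTopology.SingularHomology.singularCohomology R R X n ≃ₗ[R] Literature.AlgebraicTopology.SingularHomology.singularHomology R R X n)
    (eY : Literature.AlgebraicTopology.SingularHomology.singularCohomology R R Y n ≃ₗ[R] Literature.AlgebraicTopology.SingularHomology.singularHomology R R Y n) :
    Module.finrank R (Literature.AlgebraicTopology.SingularHomology.singularCohomology R R Z n) = Module.finrank R (Literature.AlgebraicTopology.SingularHomology.singularHomology R R Z n) :=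
  LinearEquiv.finrank_eq
    ((Literature.AlgebraicTopology.SingularHomology.singularCohomology.sumEquivOfHomeomorph R R e n).trans
      ((LinearEquiv.prodCongr eX eY).trans (Literature.AlgebraicTopology.SingularHomology.singularHomology.sumEquivOfHomeomorph R R e n)))


end SumHomeo

/-! ### Injectivity of `⌢ ([M] - [N])` on the boundary from Poincaré duality of the ends -/

section CapBoundary

variable {R : Type v} [CommRing R]
variable {X Y Z : Type u} [TopologicalSpace X] [TopologicalSpace Y] [TopologicalSpace Z]

/-- **Duality on an embedded disjoint union from duality on the pieces.**  If `Z ≅ X ⊔ Y` via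
`iX`, `iY`, `cX ∈ Hₙ(X; R)`, `cY ∈ Hₙ(Y; R)` and `b ↦ b ⌢ cX`, `b ↦ b ⌢ cY` are injective on
`Hᵖ(X; R)`, `Hᵖ(Y; R)`, then `b ↦ b ⌢ (iX_* cX - iY_* cY)` is injective on `Hᵖ(Z; R)`: by the
projection formula `b ⌢ iX_* cX = iX_*(iX^* b ⌢ cX)` (`Literature.AlgebraicTopology.SingularHomology.capProduct_map`) and additivity
(Hatcher 2002, §3.3 p. 241 and Prop. 2.6). [cite: Hatcher2002, §3.3 p. 241] -/
theorem injective_capProduct_sub_of_homeomorph (e : X ⊕ Y ≃ₜ Z) (iX : C(X, Z)) (iY : C(Y, Z))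
    (hX : ∀ x, iX x = e (Sum.inl x)) (hY : ∀ y, iY y = e (Sum.inr y)) {p q n : ℕ} (h : p + q = n)
    (cX : Literature.AlgebraicTopology.SingularHomology.singularHomology R R X n) (cY : Literature.AlgebraicTopology.SingularHomology.singularHomology R R Y n)
    (hDX : Function.Injective ((Literature.AlgebraicTopology.SingularHomology.capProduct (M := R) (X := X) h).flip cX))
    (hDY : Function.Injective ((Literature.AlgebraicTopology.SingularHomology.capProduct (M := R) (X := Y) h).flip cY)) :
    Function.Injective ((Literature.AlgebraicTopology.SingularHomology.capProduct (M := R) (X := Z) h).flip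
      (Literature.AlgebraicTopology.SingularHomology.singularHomology.map R R iX n cX - Literature.AlgebraicTopology.SingularHomology.singularHomology.map R R iY n cY)) := by
  rw [injective_iff_map_eq_zero]
  intro b hb
  rw [LinearMap.flip_apply, map_sub, ← Literature.AlgebraicTopology.SingularHomology.capProduct_map, ← Literature.AlgebraicTopology.SingularHomology.capProduct_map, sub_eq_add_neg, ← map_neg,
    Literature.AlgebraicTopology.SingularHomology.singularHomology.map_add_map_eq_zero_iff_of_homeomorph e iX iY hX hY, neg_eq_zero] at hb
  have h1 : Literature.AlgebraicTopology.SingularHomology.singularCohomology.map R R iX p b = 0 :=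
    (injective_iff_map_eq_zero _).mp hDX _ hb.1
  have h2 : Literature.AlgebraicTopology.SingularHomology.singularCohomology.map R R iY p b = 0 :=
    (injective_iff_map_eq_zero _).mp hDY _ hb.2
  exact (Literature.AlgebraicTopology.SingularHomology.singularCohomology.eq_zero_iff_of_homeomorph e iX iY hX hY p b).mpr ⟨h1, h2⟩

end CapBoundary

/-! ### The boundary of a cobordism as an embedded disjoint union `M ⊔ N` -/

namespace Cobordism

variable {n : ℕ} {M N : Type u} [TopologicalSpace M] [ChartedSpace (EuclideanSpace ℝ (Fin n)) M]
  [TopologicalSpace N] [ChartedSpace (EuclideanSpace ℝ (Fin n)) N]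

/-- The map `M ⊕ N → ∂W`, `Sum.elim inlBoundary inrBoundary` (Milnor 1965, §1: `∂W = M ⊔ N`). [cite: Milnor1965, §1] -/
def boundarySumMap (c : Cobordism n M N) : C(M ⊕ N, ↥((𝓡∂ (n + 1)).boundary c.W)) :=
  ⟨Sum.elim c.inlBoundary c.inrBoundary, Continuous.sumElim c.inlBoundary.continuous c.inrBoundary.continuous⟩

/-- `boundarySumMap (inl x) = inlBoundary x`. [folklore] -/
@[simp]
lemma boundarySumMap_inl (c : Cobordism n M N) (x : M) : c.boundarySumMap (Sum.inl x) = c.inlBoundary x := rfl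

/-- `boundarySumMap (inr y) = inrBoundary y`. [folklore] -/
@[simp]
lemma boundarySumMap_inr (c : Cobordism n M N) (y : N) : c.boundarySumMap (Sum.inr y) = c.inrBoundary y := rfl

/-- `M ⊕ N → ∂W` is bijective: the two ends are embedded disjointly and cover the boundary
(Milnor 1965, §1). [cite: Milnor1965, §1] -/
theorem boundarySumMap_bijective (c : Cobordism n M N) : Function.Bijective c.boundarySumMap := by
  constructor
  · rintro (x | x) (y | y) hxy
    · have h : c.inl x = c.inl y := congrArg Subtype.val hxy
      rw [c.isSmoothEmbedding_inl.isEmbedding.injective h]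
    · have h : c.inl x = c.inr y := congrArg Subtype.val hxy
      exact (Set.disjoint_left.mp c.disjoint_range ⟨x, rfl⟩ ⟨y, h.symm⟩).elim
    · have h : c.inr x = c.inl y := congrArg Subtype.val hxy
      exact (Set.disjoint_left.mp c.disjoint_range ⟨y, rfl⟩ ⟨x, h⟩).elim
    · have h : c.inr x = c.inr y := congrArg Subtype.val hxy
      rw [c.isSmoothEmbedding_inr.isEmbedding.injective h]
  · rintro ⟨z, hz⟩
    rw [← c.range_inl_union_range_inr] at hz
    rcases hz with ⟨x, rfl⟩ | ⟨y, rfl⟩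
    · exact ⟨Sum.inl x, rfl⟩
    · exact ⟨Sum.inr y, rfl⟩

/-- **`∂W ≅ M ⊔ N`**: the homeomorphism `M ⊕ N ≃ₜ ∂W` of a cobordism between compact manifolds
(a continuous bijection from a compact space to a Hausdorff space; Milnor 1965, §1). [cite: Milnor1965, §1] -/
def boundaryHomeomorph [CompactSpace M] [CompactSpace N] (c : Cobordism n M N) :
    M ⊕ N ≃ₜ ↥((𝓡∂ (n + 1)).boundary c.W) :=
  Continuous.homeoOfEquivCompactToT2 (f := Equiv.ofBijective _ c.boundarySumMap_bijective)
    c.boundarySumMap.continuous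

/-- `boundaryHomeomorph (inl x) = inlBoundary x`. [folklore] -/
lemma boundaryHomeomorph_inl [CompactSpace M] [CompactSpace N] (c : Cobordism n M N) (x : M) :
    c.boundaryHomeomorph (Sum.inl x) = c.inlBoundary x := rfl

/-- `boundaryHomeomorph (inr y) = inrBoundary y`. [folklore] -/
lemma boundaryHomeomorph_inr [CompactSpace M] [CompactSpace N] (c : Cobordism n M N) (y : N) :
    c.boundaryHomeomorph (Sum.inr y) = c.inrBoundary y := rfl

/-- The end inclusion `inl : M → W` is the boundary inclusion followed by `∂W ⊂ W`. [folklore] -/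
lemma inl_eq_val_comp_inlBoundary (c : Cobordism n M N) :
    (⟨c.inl, c.continuous_inl⟩ : C(M, c.W)) =
      (⟨Subtype.val, continuous_subtype_val⟩ : C(↥((𝓡∂ (n + 1)).boundary c.W), c.W)).comp c.inlBoundary :=
  rfl

/-- The end inclusion `inr : N → W` is the boundary inclusion followed by `∂W ⊂ W`. [folklore] -/
lemma inr_eq_val_comp_inrBoundary (c : Cobordism n M N) :
    (⟨c.inr, c.continuous_inr⟩ : C(N, c.W)) =
      (⟨Subtype.val, continuous_subtype_val⟩ : C(↥((𝓡∂ (n + 1)).boundary c.W), c.W)).comp c.inrBoundary :=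
  rfl

end Cobordism

/-! ### Ranks on the boundary of a cobordism -/

namespace Cobordism

variable {R : Type v} [CommRing R]
variable {n : ℕ} {M N : Type u} [TopologicalSpace M] [ChartedSpace (EuclideanSpace ℝ (Fin n)) M]
  [TopologicalSpace N] [ChartedSpace (EuclideanSpace ℝ (Fin n)) N]

variable (R) in
/-- The restriction `Hᵏ(∂W; R) → Hᵏ(M; R)/T ⊕ Hᵏ(N; R)/T`, `b ↦ ([inl_∂^* b], [inr_∂^* b])`:
the isomorphism `Hᵏ(∂W) ≅ Hᵏ(M) × Hᵏ(N)` (additivity) followed by reduction modulo torsion. [folklore] -/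
def boundaryPairRestrict (c : Cobordism n M N) (k : ℕ) :
    ↥(Literature.AlgebraicTopology.SingularHomology.singularCohomology R R ↥((𝓡∂ (n + 1)).boundary c.W) k) →ₗ[R] ↥(freeCohomologyPair R M N k) :=
  LinearMap.prod (Literature.AlgebraicTopology.SingularHomology.freeCohomology.mk ∘ₗ (Literature.AlgebraicTopology.SingularHomology.singularCohomology.map R R c.inlBoundary k).hom)
    (Literature.AlgebraicTopology.SingularHomology.freeCohomology.mk ∘ₗ (Literature.AlgebraicTopology.SingularHomology.singularCohomology.map R R c.inrBoundary k).hom)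

/-- `boundaryRestrict = boundaryPairRestrict ∘ i^*` with `i : ∂W ⊂ W` (the end inclusions factor
through the boundary). [folklore] -/
lemma boundaryRestrict_eq_comp (c : Cobordism n M N) (k : ℕ) :
    c.boundaryRestrict R k = (c.boundaryPairRestrict R k).comp
      (Literature.AlgebraicTopology.SingularHomology.singularCohomology.map R R
        (⟨Subtype.val, continuous_subtype_val⟩ : C(↥((𝓡∂ (n + 1)).boundary c.W), c.W)) k).hom := by
  refine LinearMap.ext fun a => Prod.ext ?_ ?_
  · change Literature.AlgebraicTopology.SingularHomology.freeCohomology.mk (Literature.AlgebraicTopology.SingularHomology.singularCohomology.map R R (⟨c.inl, c.continuous_inl⟩ : C(M, c.W)) k a) =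
      Literature.AlgebraicTopology.SingularHomology.freeCohomology.mk (Literature.AlgebraicTopology.SingularHomology.singularCohomology.map R R c.inlBoundary k (Literature.AlgebraicTopology.SingularHomology.singularCohomology.map R R _ k a))
    rw [inl_eq_val_comp_inlBoundary, Literature.AlgebraicTopology.SingularHomology.singularCohomology.map_comp, ModuleCat.comp_apply]
  · change Literature.AlgebraicTopology.SingularHomology.freeCohomology.mk (Literature.AlgebraicTopology.SingularHomology.singularCohomology.map R R (⟨c.inr, c.continuous_inr⟩ : C(N, c.W)) k a) =
      Literature.AlgebraicTopology.SingularHomology.freeCohomology.mk (Literature.AlgebraicTopology.SingularHomology.singularCohomology.map R R c.inrBoundary k (Literature.AlgebraicTopology.SingularHomology.singularCohomology.map R R _ k a))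
    rw [inr_eq_val_comp_inrBoundary, Literature.AlgebraicTopology.SingularHomology.singularCohomology.map_comp, ModuleCat.comp_apply]

/-- Thom's `Aᵏ` is the image of `im (i^* : Hᵏ(W) → Hᵏ(∂W))` under `boundaryPairRestrict`. [folklore] -/
lemma boundaryImage_eq_map (c : Cobordism n M N) (k : ℕ) :
    c.boundaryImage R k = (LinearMap.range (Literature.AlgebraicTopology.SingularHomology.singularCohomology.map R R
      (⟨Subtype.val, continuous_subtype_val⟩ : C(↥((𝓡∂ (n + 1)).boundary c.W), c.W)) k).hom).map
        (c.boundaryPairRestrict R k) := by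
  rw [boundaryImage, boundaryRestrict_eq_comp, LinearMap.range_comp]

/-- The kernel of `Hᵏ(∂W) → Hᵏ(M)/T ⊕ Hᵏ(N)/T` consists of torsion classes (over a domain): a
class whose restrictions to `M` and `N` are torsion is torsion, by additivity. [folklore] -/
lemma ker_boundaryPairRestrict_le_torsion [IsDomain R] [CompactSpace M] [CompactSpace N]
    (c : Cobordism n M N) (k : ℕ) :
    LinearMap.ker (c.boundaryPairRestrict R k) ≤
      Submodule.torsion R ↥(Literature.AlgebraicTopology.SingularHomology.singularCohomology R R ↥((𝓡∂ (n + 1)).boundary c.W) k) := by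
  intro b hb
  rw [LinearMap.mem_ker] at hb
  have h1 : Literature.AlgebraicTopology.SingularHomology.freeCohomology.mk (Literature.AlgebraicTopology.SingularHomology.singularCohomology.map R R c.inlBoundary k b) = 0 := congrArg Prod.fst hb
  have h2 : Literature.AlgebraicTopology.SingularHomology.freeCohomology.mk (Literature.AlgebraicTopology.SingularHomology.singularCohomology.map R R c.inrBoundary k b) = 0 := congrArg Prod.snd hb
  rw [Literature.AlgebraicTopology.SingularHomology.freeCohomology.mk_eq_zero_iff, Submodule.mem_torsion_iff] at h1 h2
  obtain ⟨r, hr⟩ := h1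
  obtain ⟨s, hs⟩ := h2
  refine (Submodule.mem_torsion_iff b).mpr ⟨r * s, ?_⟩
  refine (Literature.AlgebraicTopology.SingularHomology.singularCohomology.eq_zero_iff_of_homeomorph c.boundaryHomeomorph c.inlBoundary c.inrBoundary
    (fun x => rfl) (fun y => rfl) k _).mpr ⟨?_, ?_⟩
  · change Literature.AlgebraicTopology.SingularHomology.singularCohomology.map R R c.inlBoundary k (((r * s : nonZeroDivisors R) : R) • b) = 0
    rw [map_smul, Submonoid.coe_mul, mul_comm, mul_smul]
    change (s : R) • ((r : R) • Literature.AlgebraicTopology.SingularHomology.singularCohomology.map R R c.inlBoundary k b) = 0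
    rw [show (r : R) • Literature.AlgebraicTopology.SingularHomology.singularCohomology.map R R c.inlBoundary k b = 0 from hr, smul_zero]
  · change Literature.AlgebraicTopology.SingularHomology.singularCohomology.map R R c.inrBoundary k (((r * s : nonZeroDivisors R) : R) • b) = 0
    rw [map_smul, Submonoid.coe_mul, mul_smul]
    change (r : R) • ((s : R) • Literature.AlgebraicTopology.SingularHomology.singularCohomology.map R R c.inrBoundary k b) = 0
    rw [show (s : R) • Literature.AlgebraicTopology.SingularHomology.singularCohomology.map R R c.inrBoundary k b = 0 from hs, smul_zero]

/-- **`r_k = rank (im i^* : Hᵏ(W) → Hᵏ(∂W))`**: reducing modulo torsion and splitting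
`∂W ≅ M ⊔ N` does not change the rank of Thom's `Aᵏ` (Thom 1952, Ch. V §II, p. 173, where
coefficients are a field; over a domain, ranks). [cite: Thom1952, Ch. V §II p. 173] -/
theorem boundaryImageRank_eq_finrank_range [IsDomain R] [IsNoetherianRing R] [CompactSpace M]
    [CompactSpace N] (c : Cobordism n M N) (k : ℕ)
    [Module.Finite R ↥(Literature.AlgebraicTopology.SingularHomology.singularCohomology R R ↥((𝓡∂ (n + 1)).boundary c.W) k)] :
    c.boundaryImageRank R k = Module.finrank R ↥(LinearMap.range (Literature.AlgebraicTopology.SingularHomology.singularCohomology.map R R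
      (⟨Subtype.val, continuous_subtype_val⟩ : C(↥((𝓡∂ (n + 1)).boundary c.W), c.W)) k).hom) := by
  rw [boundaryImageRank_eq, boundaryImage_eq_map]
  exact Literature.AlgebraicTopology.SingularHomology.finrank_map_eq_of_ker_le_torsion _ (c.ker_boundaryPairRestrict_le_torsion k) _

end Cobordism

/-- `rank (Hᵏ(X; R)/T) = rank Hᵏ(X; R)` for finitely generated cohomology over a Noetherian
domain. [folklore] -/
theorem finrank_freeCohomology_eq {R : Type v} [CommRing R] [IsDomain R] [IsNoetherianRing R]
    {X : Type u} [TopologicalSpace X] (k : ℕ) [Module.Finite R ↥(Literature.AlgebraicTopology.SingularHomology.singularCohomology R R X k)] :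
    Module.finrank R ↥(Literature.AlgebraicTopology.SingularHomology.freeCohomology R X k) = Module.finrank R ↥(Literature.AlgebraicTopology.SingularHomology.singularCohomology R R X k) :=
  Literature.AlgebraicTopology.SingularHomology.finrank_quotient_torsion

section SPC4

/-! ### Thom V.8 for an oriented cobordism: `2·r₂ = b₂(M) + b₂(N)` from the named leaves -/

/-- **Thom (1952) Cor. V.8 in dimension `4 + 1`, for a cobordism carrying a relative fundamental
class** (the printed hypothesis "`M^{n+1}` compact orientable", here `w` a relative fundamental
class of `(W, ∂W)`, Spanier's definition): **`2 · r₂ = rank H²(M; ℤ)/T + rank H²(N; ℤ)/T`**.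
PROVED from: Lefschetz duality for `(W, ∂W)` (named fact
`bijective_relCapProduct_of_isRelFundamentalClass`, hypothesis `hL`), Poincaré duality of the
two ends (named fact `bijective_poincareDualityMap`, `hDM`, `hDN`), universal coefficients
(named facts `kroneckerMap_surjective` for `W`, `ker_kroneckerMap_le_torsion` for `∂W`; `hU1`,
`hU2`), finite generation of the (co)homology involved (named facts
`finite_singular(Co)homology_of_compactSpace` for the closed ends, hypotheses `hF…`; for the
compact manifold with boundary `W`, Spanier Cor. 6.2.21, `finite_singularHomology_of_isRelFundamentalClass`, `hFW`), through "half lives, half dies"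
(`two_mul_finrank_range_cohomologyMap_eq`) and the additivity `∂W ≅ M ⊔ N`.
[cite: Thom1952, Cor. V.8 (p. 173); Hatcher2002, §3.3 Thm. 3.43] -/
theorem two_mul_boundaryImageRank_eq_of_isRelFundamentalClass
    {M N : Type u} [TopologicalSpace M] [T2Space M] [SecondCountableTopology M]
    [ChartedSpace (EuclideanSpace ℝ (Fin 4)) M] [CompactSpace M] [IsManifold (𝓡 4) ∞ M]
    [TopologicalSpace N] [T2Space N] [SecondCountableTopology N]
    [ChartedSpace (EuclideanSpace ℝ (Fin 4)) N] [CompactSpace N] [IsManifold (𝓡 4) ∞ N]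
    (μ : Literature.AlgebraicTopology.SingularHomology.HomologicalOrientation ℤ M 4) (ν : Literature.AlgebraicTopology.SingularHomology.HomologicalOrientation ℤ N 4) (c : Cobordism 4 M N)
    (w : ↥(Literature.AlgebraicTopology.SingularHomology.relativeSingularHomology ℤ ℤ c.W ((𝓡∂ (4 + 1)).boundary c.W) (4 + 1)))
    (hw : Literature.AlgebraicTopology.SingularHomology.relativeSingularHomology.δ ℤ ℤ c.W ((𝓡∂ (4 + 1)).boundary c.W) 4 w =
      Literature.AlgebraicTopology.SingularHomology.singularHomology.map ℤ ℤ c.inlBoundary 4 μ.fundamentalClass -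
        Literature.AlgebraicTopology.SingularHomology.singularHomology.map ℤ ℤ c.inrBoundary 4 ν.fundamentalClass)
    (hfund : Literature.AlgebraicTopology.SingularHomology.IsRelFundamentalClass ℤ ((𝓡∂ (4 + 1)).boundary c.W) w)
    (hL : Literature.AlgebraicTopology.SingularHomology.bijective_relCapProduct_of_isRelFundamentalClass ℤ 4 c.W w hfund
      (show 2 + (2 + 1) = 4 + 1 by rfl))
    (hDM : Literature.AlgebraicTopology.SingularHomology.bijective_poincareDualityMap μ two_add_two_eq_four)
    (hDN : Literature.AlgebraicTopology.SingularHomology.bijective_poincareDualityMap ν two_add_two_eq_four)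
    (hU1 : Literature.AlgebraicTopology.SingularHomology.kroneckerMap_surjective ℤ c.W 2)
    (hU2 : Literature.AlgebraicTopology.SingularHomology.ker_kroneckerMap_le_torsion ℤ ↥((𝓡∂ (4 + 1)).boundary c.W) 1)
    (hFM2 : Literature.AlgebraicTopology.SingularHomology.finite_singularCohomology_of_compactSpace ℤ M 4 2)
    (hFN2 : Literature.AlgebraicTopology.SingularHomology.finite_singularCohomology_of_compactSpace ℤ N 4 2)
    (hFM₂ : Literature.AlgebraicTopology.SingularHomology.finite_singularHomology_of_compactSpace ℤ M 4 2)
    (hFN₂ : Literature.AlgebraicTopology.SingularHomology.finite_singularHomology_of_compactSpace ℤ N 4 2)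
    (hFM₁ : Literature.AlgebraicTopology.SingularHomology.finite_singularHomology_of_compactSpace ℤ M 4 1)
    (hFN₁ : Literature.AlgebraicTopology.SingularHomology.finite_singularHomology_of_compactSpace ℤ N 4 1)
    (hFW : Literature.AlgebraicTopology.SingularHomology.finite_singularHomology_of_isRelFundamentalClass ℤ 4 c.W w hfund 2) :
    2 * c.boundaryImageRank ℤ 2 =
      Module.finrank ℤ ↥(Literature.AlgebraicTopology.SingularHomology.freeCohomology ℤ M 2) + Module.finrank ℤ ↥(Literature.AlgebraicTopology.SingularHomology.freeCohomology ℤ N 2) := by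
  have hXl : ∀ x, c.inlBoundary x = c.boundaryHomeomorph (Sum.inl x) := fun x => rfl
  have hYr : ∀ y, c.inrBoundary y = c.boundaryHomeomorph (Sum.inr y) := fun y => rfl
  -- finiteness on the boundary, transported from the ends
  haveI : Module.Finite ℤ ↥(Literature.AlgebraicTopology.SingularHomology.singularCohomology ℤ ℤ M 2) := hFM2
  haveI : Module.Finite ℤ ↥(Literature.AlgebraicTopology.SingularHomology.singularCohomology ℤ ℤ N 2) := hFN2
  haveI : Module.Finite ℤ ↥(Literature.AlgebraicTopology.SingularHomology.singularHomology ℤ ℤ M 2) := hFM₂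
  haveI : Module.Finite ℤ ↥(Literature.AlgebraicTopology.SingularHomology.singularHomology ℤ ℤ N 2) := hFN₂
  haveI : Module.Finite ℤ ↥(Literature.AlgebraicTopology.SingularHomology.singularHomology ℤ ℤ M 1) := hFM₁
  haveI : Module.Finite ℤ ↥(Literature.AlgebraicTopology.SingularHomology.singularHomology ℤ ℤ N 1) := hFN₁
  haveI := Literature.AlgebraicTopology.SingularHomology.singularCohomology.finite_of_homeomorph (R := ℤ) (M' := ℤ) c.boundaryHomeomorph 2
  haveI := Literature.AlgebraicTopology.SingularHomology.singularHomology.finite_of_homeomorph (R := ℤ) (M' := ℤ) c.boundaryHomeomorph 2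
  haveI := Literature.AlgebraicTopology.SingularHomology.singularHomology.finite_of_homeomorph (R := ℤ) (M' := ℤ) c.boundaryHomeomorph 1
  haveI : Module.Finite ℤ ↥(Literature.AlgebraicTopology.SingularHomology.singularHomology ℤ ℤ c.W 2) := hFW.1
  -- (D): injectivity of `⌢ ∂w` on `H²(∂W)` from Poincaré duality of the ends
  have hD := injective_capProduct_sub_of_homeomorph (R := ℤ) c.boundaryHomeomorph c.inlBoundary
    c.inrBoundary hXl hYr two_add_two_eq_four μ.fundamentalClass ν.fundamentalClass hDM.1 hDN.1
  rw [← hw] at hD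
  -- (K): universal coefficients
  have hK := Literature.AlgebraicTopology.SingularHomology.finrank_range_cohomologyMap_eq_finrank_range_homologyMap (R := ℤ)
    (⟨Subtype.val, continuous_subtype_val⟩ : C(↥((𝓡∂ (4 + 1)).boundary c.W), c.W)) (p := 2) hU1 hU2
  -- half lives, half dies
  have main := Literature.AlgebraicTopology.SingularHomology.two_mul_finrank_range_cohomologyMap_eq (R := ℤ) two_add_two_eq_four w hL.2 hD hK
  -- translations
  rw [c.boundaryImageRank_eq_finrank_range (R := ℤ) 2, finrank_freeCohomology_eq,
    finrank_freeCohomology_eq,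
    ← Literature.AlgebraicTopology.SingularHomology.singularCohomology.finrank_eq_add_of_homeomorph (R := ℤ) (M' := ℤ) c.boundaryHomeomorph 2,
    finrank_singularCohomology_eq_finrank_singularHomology_of_homeomorph (R := ℤ) c.boundaryHomeomorph 2
      (Literature.AlgebraicTopology.SingularHomology.poincareDualityEquiv μ two_add_two_eq_four hDM) (Literature.AlgebraicTopology.SingularHomology.poincareDualityEquiv ν two_add_two_eq_four hDN)]
  exact main

end SPC4

end Literature.Topology.FourManifolds


/-! ### Layer 3b: the same for topological boundary splittings `∂W = M ⊔ N`

The theorem of Layer 3 uses no smoothness: only that the two ends are embedded continuously,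
injectively and disjointly onto the boundary of a compact topological manifold with boundary.
We record it in that generality (`Literature.Topology.FourManifolds.BoundarySplitting`), which is the form consumed by the
bookkeeping of the next layer (restriction of a cobordism to the union `W'` of the components of
`W` meeting `∂W`, an open submanifold on which no smooth embedding data is needed).
-/

namespace Literature.Topology.FourManifolds

/-- **A topological splitting of the boundary, `∂W = M ⊔ N`** (Milnor, *Lectures on the
h-cobordism theorem* (1965), §1: a cobordism is `(W; V₀, V₁)` with `∂W` the disjoint union of
`V₀` and `V₁`), without smoothness: `W` a topological `(n+1)`-manifold with boundary
(`ChartedSpace (EuclideanHalfSpace (n + 1)) W`), and continuous injections `iM : M → W`,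
`iN : N → W` with disjoint images whose union is the boundary `(𝓡∂ (n + 1)).boundary W`.  Every
`Literature.Cobordism n M N` gives one (`Cobordism.toBoundarySplitting`); so does the restriction of a
cobordism to a clopen union of components containing the ends. [cite: Milnor1965, §1] -/
structure BoundarySplitting (n : ℕ) (M N : Type u) [TopologicalSpace M] [TopologicalSpace N]
    (W : Type u) [TopologicalSpace W] [ChartedSpace (EuclideanHalfSpace (n + 1)) W] where
  /-- The inclusion of the incoming end. -/
  iM : C(M, W)
  /-- The inclusion of the outgoing end. -/
  iN : C(N, W)
  /-- `iM` is injective. -/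
  injective_iM : Function.Injective iM
  /-- `iN` is injective. -/
  injective_iN : Function.Injective iN
  /-- The two ends are disjoint in `W`. -/
  disjoint_range : Disjoint (Set.range iM) (Set.range iN)
  /-- The two ends cover the boundary. -/
  range_union : Set.range iM ∪ Set.range iN = (𝓡∂ (n + 1)).boundary W

namespace Cobordism

variable {n : ℕ} {M N : Type u} [TopologicalSpace M] [ChartedSpace (EuclideanSpace ℝ (Fin n)) M]
  [TopologicalSpace N] [ChartedSpace (EuclideanSpace ℝ (Fin n)) N]

/-- The boundary splitting underlying a (smooth) cobordism (Milnor 1965, §1). [cite: Milnor1965, §1] -/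
def toBoundarySplitting (c : Cobordism n M N) : BoundarySplitting n M N c.W where
  iM := ⟨c.inl, c.continuous_inl⟩
  iN := ⟨c.inr, c.continuous_inr⟩
  injective_iM := c.isSmoothEmbedding_inl.isEmbedding.injective
  injective_iN := c.isSmoothEmbedding_inr.isEmbedding.injective
  disjoint_range := c.disjoint_range
  range_union := c.range_inl_union_range_inr

/-- Unfolding: the first end of `c.toBoundarySplitting` is `inl`. [folklore] -/
@[simp]
lemma toBoundarySplitting_iM (c : Cobordism n M N) : c.toBoundarySplitting.iM = ⟨c.inl, c.continuous_inl⟩ := rfl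

/-- Unfolding: the second end of `c.toBoundarySplitting` is `inr`. [folklore] -/
@[simp]
lemma toBoundarySplitting_iN (c : Cobordism n M N) : c.toBoundarySplitting.iN = ⟨c.inr, c.continuous_inr⟩ := rfl

end Cobordism

namespace BoundarySplitting

variable {n : ℕ} {M N W : Type u} [TopologicalSpace M] [TopologicalSpace N] [TopologicalSpace W]
  [ChartedSpace (EuclideanHalfSpace (n + 1)) W]

/-- Points of the first end lie on the boundary. [folklore] -/
lemma iM_mem_boundary (s : BoundarySplitting n M N W) (x : M) : s.iM x ∈ (𝓡∂ (n + 1)).boundary W := by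
  rw [← s.range_union]; exact Or.inl ⟨x, rfl⟩

/-- Points of the second end lie on the boundary. [folklore] -/
lemma iN_mem_boundary (s : BoundarySplitting n M N W) (y : N) : s.iN y ∈ (𝓡∂ (n + 1)).boundary W := by
  rw [← s.range_union]; exact Or.inr ⟨y, rfl⟩

/-- The first end corestricted to the boundary, `M → ∂W`. [folklore] -/
def iMB (s : BoundarySplitting n M N W) : C(M, ↥((𝓡∂ (n + 1)).boundary W)) where
  toFun x := ⟨s.iM x, s.iM_mem_boundary x⟩
  continuous_toFun := s.iM.continuous.subtype_mk _

/-- The second end corestricted to the boundary, `N → ∂W`. [folklore] -/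
def iNB (s : BoundarySplitting n M N W) : C(N, ↥((𝓡∂ (n + 1)).boundary W)) where
  toFun y := ⟨s.iN y, s.iN_mem_boundary y⟩
  continuous_toFun := s.iN.continuous.subtype_mk _

/-- `iMB x = iM x` in `W`. [folklore] -/
@[simp]
lemma coe_iMB_apply (s : BoundarySplitting n M N W) (x : M) : (s.iMB x : W) = s.iM x := rfl

/-- `iNB y = iN y` in `W`. [folklore] -/
@[simp]
lemma coe_iNB_apply (s : BoundarySplitting n M N W) (y : N) : (s.iNB y : W) = s.iN y := rfl

/-- `iM = (∂W ⊂ W) ∘ iMB`. [folklore] -/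
lemma iM_eq_val_comp_iMB (s : BoundarySplitting n M N W) :
    s.iM = (⟨Subtype.val, continuous_subtype_val⟩ : C(↥((𝓡∂ (n + 1)).boundary W), W)).comp s.iMB := by
  ext x; rfl

/-- `iN = (∂W ⊂ W) ∘ iNB`. [folklore] -/
lemma iN_eq_val_comp_iNB (s : BoundarySplitting n M N W) :
    s.iN = (⟨Subtype.val, continuous_subtype_val⟩ : C(↥((𝓡∂ (n + 1)).boundary W), W)).comp s.iNB := by
  ext y; rfl

/-- The map `M ⊕ N → ∂W`, `Sum.elim iMB iNB`. [folklore] -/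
def sumMap (s : BoundarySplitting n M N W) : C(M ⊕ N, ↥((𝓡∂ (n + 1)).boundary W)) :=
  ⟨Sum.elim s.iMB s.iNB, Continuous.sumElim s.iMB.continuous s.iNB.continuous⟩

/-- `M ⊕ N → ∂W` is bijective (Milnor 1965, §1). [cite: Milnor1965, §1] -/
theorem sumMap_bijective (s : BoundarySplitting n M N W) : Function.Bijective s.sumMap := by
  constructor
  · rintro (x | x) (y | y) hxy
    · have h : s.iM x = s.iM y := congrArg Subtype.val hxy
      rw [s.injective_iM h]
    · have h : s.iM x = s.iN y := congrArg Subtype.val hxy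
      exact (Set.disjoint_left.mp s.disjoint_range ⟨x, rfl⟩ ⟨y, h.symm⟩).elim
    · have h : s.iN x = s.iM y := congrArg Subtype.val hxy
      exact (Set.disjoint_left.mp s.disjoint_range ⟨y, rfl⟩ ⟨x, h⟩).elim
    · have h : s.iN x = s.iN y := congrArg Subtype.val hxy
      rw [s.injective_iN h]
  · rintro ⟨z, hz⟩
    rw [← s.range_union] at hz
    rcases hz with ⟨x, rfl⟩ | ⟨y, rfl⟩
    · exact ⟨Sum.inl x, rfl⟩
    · exact ⟨Sum.inr y, rfl⟩

/-- **`∂W ≅ M ⊔ N`**: the homeomorphism `M ⊕ N ≃ₜ ∂W` for compact ends and Hausdorff `W`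
(continuous bijection from a compact to a Hausdorff space; Milnor 1965, §1). [cite: Milnor1965, §1] -/
def homeomorph [CompactSpace M] [CompactSpace N] [T2Space W] (s : BoundarySplitting n M N W) :
    M ⊕ N ≃ₜ ↥((𝓡∂ (n + 1)).boundary W) :=
  Continuous.homeoOfEquivCompactToT2 (f := Equiv.ofBijective _ s.sumMap_bijective) s.sumMap.continuous

/-- `homeomorph (inl x) = iMB x`. [folklore] -/
lemma homeomorph_inl [CompactSpace M] [CompactSpace N] [T2Space W] (s : BoundarySplitting n M N W) (x : M) :
    s.homeomorph (Sum.inl x) = s.iMB x := rfl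

/-- `homeomorph (inr y) = iNB y`. [folklore] -/
lemma homeomorph_inr [CompactSpace M] [CompactSpace N] [T2Space W] (s : BoundarySplitting n M N W) (y : N) :
    s.homeomorph (Sum.inr y) = s.iNB y := rfl

variable (R : Type v) [CommRing R]

/-- Restriction of classes of `W` to the two ends, reduced modulo torsion:
`Hᵏ(W; R) → Hᵏ(M; R)/T ⊕ Hᵏ(N; R)/T`, `a ↦ ([iM^* a], [iN^* a])` (Thom 1952, Ch. V §II, p. 173,
`f^*` for `f : ∂W → W`).  For a cobordism this is `Cobordism.boundaryRestrict`
(`Cobordism.boundaryRestrict_eq_restrict`). [cite: Thom1952, Ch. V §II p. 173] -/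
def restrict (s : BoundarySplitting n M N W) (k : ℕ) :
    ↥(Literature.AlgebraicTopology.SingularHomology.singularCohomology R R W k) →ₗ[R] ↥(freeCohomologyPair R M N k) :=
  LinearMap.prod (Literature.AlgebraicTopology.SingularHomology.freeCohomology.mk ∘ₗ (Literature.AlgebraicTopology.SingularHomology.singularCohomology.map R R s.iM k).hom)
    (Literature.AlgebraicTopology.SingularHomology.freeCohomology.mk ∘ₗ (Literature.AlgebraicTopology.SingularHomology.singularCohomology.map R R s.iN k).hom)

/-- The restriction `Hᵏ(∂W; R) → Hᵏ(M; R)/T ⊕ Hᵏ(N; R)/T`, `b ↦ ([iMB^* b], [iNB^* b])`. [folklore] -/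
def pairRestrict (s : BoundarySplitting n M N W) (k : ℕ) :
    ↥(Literature.AlgebraicTopology.SingularHomology.singularCohomology R R ↥((𝓡∂ (n + 1)).boundary W) k) →ₗ[R] ↥(freeCohomologyPair R M N k) :=
  LinearMap.prod (Literature.AlgebraicTopology.SingularHomology.freeCohomology.mk ∘ₗ (Literature.AlgebraicTopology.SingularHomology.singularCohomology.map R R s.iMB k).hom)
    (Literature.AlgebraicTopology.SingularHomology.freeCohomology.mk ∘ₗ (Literature.AlgebraicTopology.SingularHomology.singularCohomology.map R R s.iNB k).hom)

/-- The rank of the image of `restrict` (Thom's `r_k`; for a cobordism, `Cobordism.boundaryImageRank`,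
see `Cobordism.boundaryImageRank_eq_restrictRank`).  Defined generically in `R` so that the
`R`-module structure on the range is the generic one (ℤ-instance discipline of this file). [cite: Thom1952, Ch. V §II p. 173] -/
def restrictRank (s : BoundarySplitting n M N W) (k : ℕ) : ℕ :=
  Module.finrank R ↥(LinearMap.range (s.restrict R k))

variable {R}

/-- `Cobordism.boundaryImageRank` is `restrictRank` of the underlying boundary splitting. [folklore] -/
lemma _root_.Literature.Topology.FourManifolds.Cobordism.boundaryImageRank_eq_restrictRank {M N : Type u} [TopologicalSpace M]
    [ChartedSpace (EuclideanSpace ℝ (Fin n)) M] [TopologicalSpace N]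
    [ChartedSpace (EuclideanSpace ℝ (Fin n)) N] (c : Cobordism n M N) (k : ℕ) :
    c.boundaryImageRank R k = c.toBoundarySplitting.restrictRank R k := rfl

/-- `Cobordism.boundaryRestrict` is `restrict` of the underlying boundary splitting. [folklore] -/
lemma _root_.Literature.Topology.FourManifolds.Cobordism.boundaryRestrict_eq_restrict {M N : Type u} [TopologicalSpace M]
    [ChartedSpace (EuclideanSpace ℝ (Fin n)) M] [TopologicalSpace N]
    [ChartedSpace (EuclideanSpace ℝ (Fin n)) N] (c : Cobordism n M N) (k : ℕ) :
    c.boundaryRestrict R k = c.toBoundarySplitting.restrict R k := rfl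

/-- `restrict = pairRestrict ∘ i^*` with `i : ∂W ⊂ W`. [folklore] -/
lemma restrict_eq_comp (s : BoundarySplitting n M N W) (k : ℕ) :
    s.restrict R k = (s.pairRestrict R k).comp (Literature.AlgebraicTopology.SingularHomology.singularCohomology.map R R
      (⟨Subtype.val, continuous_subtype_val⟩ : C(↥((𝓡∂ (n + 1)).boundary W), W)) k).hom := by
  refine LinearMap.ext fun a => Prod.ext ?_ ?_
  · change Literature.AlgebraicTopology.SingularHomology.freeCohomology.mk (Literature.AlgebraicTopology.SingularHomology.singularCohomology.map R R s.iM k a) =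
      Literature.AlgebraicTopology.SingularHomology.freeCohomology.mk (Literature.AlgebraicTopology.SingularHomology.singularCohomology.map R R s.iMB k (Literature.AlgebraicTopology.SingularHomology.singularCohomology.map R R _ k a))
    rw [← ModuleCat.comp_apply, ← Literature.AlgebraicTopology.SingularHomology.singularCohomology.map_comp, ← iM_eq_val_comp_iMB]
  · change Literature.AlgebraicTopology.SingularHomology.freeCohomology.mk (Literature.AlgebraicTopology.SingularHomology.singularCohomology.map R R s.iN k a) =
      Literature.AlgebraicTopology.SingularHomology.freeCohomology.mk (Literature.AlgebraicTopology.SingularHomology.singularCohomology.map R R s.iNB k (Literature.AlgebraicTopology.SingularHomology.singularCohomology.map R R _ k a))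
    rw [← ModuleCat.comp_apply, ← Literature.AlgebraicTopology.SingularHomology.singularCohomology.map_comp, ← iN_eq_val_comp_iNB]

/-- The kernel of `Hᵏ(∂W) → Hᵏ(M)/T ⊕ Hᵏ(N)/T` consists of torsion classes (over a domain). [folklore] -/
lemma ker_pairRestrict_le_torsion [IsDomain R] [CompactSpace M] [CompactSpace N] [T2Space W]
    (s : BoundarySplitting n M N W) (k : ℕ) :
    LinearMap.ker (s.pairRestrict R k) ≤
      Submodule.torsion R ↥(Literature.AlgebraicTopology.SingularHomology.singularCohomology R R ↥((𝓡∂ (n + 1)).boundary W) k) := by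
  intro b hb
  rw [LinearMap.mem_ker] at hb
  have h1 : Literature.AlgebraicTopology.SingularHomology.freeCohomology.mk (Literature.AlgebraicTopology.SingularHomology.singularCohomology.map R R s.iMB k b) = 0 := congrArg Prod.fst hb
  have h2 : Literature.AlgebraicTopology.SingularHomology.freeCohomology.mk (Literature.AlgebraicTopology.SingularHomology.singularCohomology.map R R s.iNB k b) = 0 := congrArg Prod.snd hb
  rw [Literature.AlgebraicTopology.SingularHomology.freeCohomology.mk_eq_zero_iff, Submodule.mem_torsion_iff] at h1 h2
  obtain ⟨r, hr⟩ := h1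
  obtain ⟨t, ht⟩ := h2
  refine (Submodule.mem_torsion_iff b).mpr ⟨r * t, ?_⟩
  refine (Literature.AlgebraicTopology.SingularHomology.singularCohomology.eq_zero_iff_of_homeomorph s.homeomorph s.iMB s.iNB
    (fun x => rfl) (fun y => rfl) k _).mpr ⟨?_, ?_⟩
  · change Literature.AlgebraicTopology.SingularHomology.singularCohomology.map R R s.iMB k (((r * t : nonZeroDivisors R) : R) • b) = 0
    rw [map_smul, Submonoid.coe_mul, mul_comm, mul_smul]
    change (t : R) • ((r : R) • Literature.AlgebraicTopology.SingularHomology.singularCohomology.map R R s.iMB k b) = 0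
    rw [show (r : R) • Literature.AlgebraicTopology.SingularHomology.singularCohomology.map R R s.iMB k b = 0 from hr, smul_zero]
  · change Literature.AlgebraicTopology.SingularHomology.singularCohomology.map R R s.iNB k (((r * t : nonZeroDivisors R) : R) • b) = 0
    rw [map_smul, Submonoid.coe_mul, mul_smul]
    change (r : R) • ((t : R) • Literature.AlgebraicTopology.SingularHomology.singularCohomology.map R R s.iNB k b) = 0
    rw [show (t : R) • Literature.AlgebraicTopology.SingularHomology.singularCohomology.map R R s.iNB k b = 0 from ht, smul_zero]

/-- **`restrictRank = rank (im i^* : Hᵏ(W) → Hᵏ(∂W))`** (Thom's `r_k`): reducing modulo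
torsion and splitting `∂W ≅ M ⊔ N` does not change the rank. [cite: Thom1952, Ch. V §II p. 173] -/
theorem restrictRank_eq [IsDomain R] [IsNoetherianRing R] [CompactSpace M] [CompactSpace N]
    [T2Space W] (s : BoundarySplitting n M N W) (k : ℕ)
    [Module.Finite R ↥(Literature.AlgebraicTopology.SingularHomology.singularCohomology R R ↥((𝓡∂ (n + 1)).boundary W) k)] :
    s.restrictRank R k =
      Module.finrank R ↥(LinearMap.range (Literature.AlgebraicTopology.SingularHomology.singularCohomology.map R R
        (⟨Subtype.val, continuous_subtype_val⟩ : C(↥((𝓡∂ (n + 1)).boundary W), W)) k).hom) := by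
  rw [restrictRank, restrict_eq_comp, LinearMap.range_comp]
  exact Literature.AlgebraicTopology.SingularHomology.finrank_map_eq_of_ker_le_torsion _ (s.ker_pairRestrict_le_torsion k) _

/-- **Thom (1952) Cor. V.8 in dimension `4 + 1` for a topological boundary splitting carrying a
relative fundamental class**: `2 · r₂ = rank H²(M; ℤ)/T + rank H²(N; ℤ)/T`, `r₂ = restrictRank ℤ 2`.
Same statement and proof as `Literature.Topology.FourManifolds.two_mul_boundaryImageRank_eq_of_isRelFundamentalClass`,
for a `BoundarySplitting 4 M N W` (no smoothness): `W` a compact Hausdorff topological 5-manifold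
with boundary, ends `M`, `N` closed topological 4-manifolds with `ℤ`-orientations `μ`, `ν`,
`w ∈ H₅(W, ∂W; ℤ)` a relative fundamental class with `∂w = (iM)_*[M]_μ − (iN)_*[N]_ν`, and the
named textbook facts as hypotheses (Lefschetz duality `hL`, Poincaré duality of the ends
`hDM hDN`, universal coefficients `hU1 hU2`, finiteness `hF…`, `hFW`).  PROVED.
[cite: Thom1952, Cor. V.8 (p. 173); Hatcher2002, §3.3 Thm. 3.43] -/
theorem two_mul_restrictRank_eq_of_isRelFundamentalClass
    {M N W : Type u} [TopologicalSpace M] [T2Space M] [ChartedSpace (EuclideanSpace ℝ (Fin 4)) M]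
    [CompactSpace M] [TopologicalSpace N] [T2Space N] [ChartedSpace (EuclideanSpace ℝ (Fin 4)) N]
    [CompactSpace N] [TopologicalSpace W] [T2Space W] [CompactSpace W]
    [ChartedSpace (EuclideanHalfSpace (4 + 1)) W] (s : BoundarySplitting 4 M N W)
    (μ : Literature.AlgebraicTopology.SingularHomology.HomologicalOrientation ℤ M 4) (ν : Literature.AlgebraicTopology.SingularHomology.HomologicalOrientation ℤ N 4)
    (w : ↥(Literature.AlgebraicTopology.SingularHomology.relativeSingularHomology ℤ ℤ W ((𝓡∂ (4 + 1)).boundary W) (4 + 1)))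
    (hw : Literature.AlgebraicTopology.SingularHomology.relativeSingularHomology.δ ℤ ℤ W ((𝓡∂ (4 + 1)).boundary W) 4 w =
      Literature.AlgebraicTopology.SingularHomology.singularHomology.map ℤ ℤ s.iMB 4 μ.fundamentalClass -
        Literature.AlgebraicTopology.SingularHomology.singularHomology.map ℤ ℤ s.iNB 4 ν.fundamentalClass)
    (hfund : Literature.AlgebraicTopology.SingularHomology.IsRelFundamentalClass ℤ ((𝓡∂ (4 + 1)).boundary W) w)
    (hL : Literature.AlgebraicTopology.SingularHomology.bijective_relCapProduct_of_isRelFundamentalClass ℤ 4 W w hfund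
      (show 2 + (2 + 1) = 4 + 1 by rfl))
    (hDM : Literature.AlgebraicTopology.SingularHomology.bijective_poincareDualityMap μ two_add_two_eq_four)
    (hDN : Literature.AlgebraicTopology.SingularHomology.bijective_poincareDualityMap ν two_add_two_eq_four)
    (hU1 : Literature.AlgebraicTopology.SingularHomology.kroneckerMap_surjective ℤ W 2)
    (hU2 : Literature.AlgebraicTopology.SingularHomology.ker_kroneckerMap_le_torsion ℤ ↥((𝓡∂ (4 + 1)).boundary W) 1)
    (hFM2 : Literature.AlgebraicTopology.SingularHomology.finite_singularCohomology_of_compactSpace ℤ M 4 2)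
    (hFN2 : Literature.AlgebraicTopology.SingularHomology.finite_singularCohomology_of_compactSpace ℤ N 4 2)
    (hFM₂ : Literature.AlgebraicTopology.SingularHomology.finite_singularHomology_of_compactSpace ℤ M 4 2)
    (hFN₂ : Literature.AlgebraicTopology.SingularHomology.finite_singularHomology_of_compactSpace ℤ N 4 2)
    (hFM₁ : Literature.AlgebraicTopology.SingularHomology.finite_singularHomology_of_compactSpace ℤ M 4 1)
    (hFN₁ : Literature.AlgebraicTopology.SingularHomology.finite_singularHomology_of_compactSpace ℤ N 4 1)
    (hFW : Literature.AlgebraicTopology.SingularHomology.finite_singularHomology_of_isRelFundamentalClass ℤ 4 W w hfund 2) :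
    2 * s.restrictRank ℤ 2 =
      Module.finrank ℤ ↥(Literature.AlgebraicTopology.SingularHomology.freeCohomology ℤ M 2) + Module.finrank ℤ ↥(Literature.AlgebraicTopology.SingularHomology.freeCohomology ℤ N 2) := by
  have hXl : ∀ x, s.iMB x = s.homeomorph (Sum.inl x) := fun x => rfl
  have hYr : ∀ y, s.iNB y = s.homeomorph (Sum.inr y) := fun y => rfl
  haveI : Module.Finite ℤ ↥(Literature.AlgebraicTopology.SingularHomology.singularCohomology ℤ ℤ M 2) := hFM2
  haveI : Module.Finite ℤ ↥(Literature.AlgebraicTopology.SingularHomology.singularCohomology ℤ ℤ N 2) := hFN2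
  haveI : Module.Finite ℤ ↥(Literature.AlgebraicTopology.SingularHomology.singularHomology ℤ ℤ M 2) := hFM₂
  haveI : Module.Finite ℤ ↥(Literature.AlgebraicTopology.SingularHomology.singularHomology ℤ ℤ N 2) := hFN₂
  haveI : Module.Finite ℤ ↥(Literature.AlgebraicTopology.SingularHomology.singularHomology ℤ ℤ M 1) := hFM₁
  haveI : Module.Finite ℤ ↥(Literature.AlgebraicTopology.SingularHomology.singularHomology ℤ ℤ N 1) := hFN₁
  haveI := Literature.AlgebraicTopology.SingularHomology.singularCohomology.finite_of_homeomorph (R := ℤ) (M' := ℤ) s.homeomorph 2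
  haveI := Literature.AlgebraicTopology.SingularHomology.singularHomology.finite_of_homeomorph (R := ℤ) (M' := ℤ) s.homeomorph 2
  haveI := Literature.AlgebraicTopology.SingularHomology.singularHomology.finite_of_homeomorph (R := ℤ) (M' := ℤ) s.homeomorph 1
  haveI : Module.Finite ℤ ↥(Literature.AlgebraicTopology.SingularHomology.singularHomology ℤ ℤ W 2) := hFW.1
  have hD := injective_capProduct_sub_of_homeomorph (R := ℤ) s.homeomorph s.iMB s.iNB hXl hYr
    two_add_two_eq_four μ.fundamentalClass ν.fundamentalClass hDM.1 hDN.1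
  rw [← hw] at hD
  have hK := Literature.AlgebraicTopology.SingularHomology.finrank_range_cohomologyMap_eq_finrank_range_homologyMap (R := ℤ)
    (⟨Subtype.val, continuous_subtype_val⟩ : C(↥((𝓡∂ (4 + 1)).boundary W), W)) (p := 2) hU1 hU2
  have main := Literature.AlgebraicTopology.SingularHomology.two_mul_finrank_range_cohomologyMap_eq (R := ℤ) two_add_two_eq_four w hL.2 hD hK
  rw [s.restrictRank_eq (R := ℤ) 2, finrank_freeCohomology_eq, finrank_freeCohomology_eq,
    ← Literature.AlgebraicTopology.SingularHomology.singularCohomology.finrank_eq_add_of_homeomorph (R := ℤ) (M' := ℤ) s.homeomorph 2,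
    finrank_singularCohomology_eq_finrank_singularHomology_of_homeomorph (R := ℤ) s.homeomorph 2
      (Literature.AlgebraicTopology.SingularHomology.poincareDualityEquiv μ two_add_two_eq_four hDM) (Literature.AlgebraicTopology.SingularHomology.poincareDualityEquiv ν two_add_two_eq_four hDN)]
  exact main

end BoundarySplitting

end Literature.Topology.FourManifolds


/-! ### Layer 3c: the leaf `two_mul_boundaryImageRank_eq` from a normalization of the bordism datum -/

namespace Literature.Topology.FourManifolds

/-- **An oriented bordism datum in normal form**: a topological boundary splitting
`∂W = M ⊔ N` of a compact Hausdorff topological `(n+1)`-manifold with boundary `W`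
(`Literature.Topology.FourManifolds.BoundarySplitting`) together with a **relative fundamental class** `w ∈ Hₙ₊₁(W, ∂W; ℤ)`
(Spanier's definition, `Literature.AlgebraicTopology.SingularHomology.IsRelFundamentalClass`) inducing the given orientations on the ends,
`∂w = (iM)_*[M]_μ − (iN)_*[N]_ν` — i.e. Thom's printed setting "`V = ∂M`, `M` compacte
orientable" (Ann. Sci. ENS 69 (1952), Ch. V §II, p. 173) for the two-ended boundary, as opposed
to the weaker homological datum of `Literature.Topology.FourManifolds.IsOrientedBordant` (whose `W` may have closed,
possibly non-orientable, components on which `w` is arbitrary).  Bundled with its instances, as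
`Literature.Topology.FourManifolds.Cobordism` is. [cite: Thom1952, Ch. V §II p. 173] -/
structure OrientedSplitting (n : ℕ) (M N : Type u) [TopologicalSpace M] [TopologicalSpace N]
    (μ : Literature.AlgebraicTopology.SingularHomology.HomologicalOrientation ℤ M n) (ν : Literature.AlgebraicTopology.SingularHomology.HomologicalOrientation ℤ N n) where
  /-- The total space, a compact topological `(n+1)`-manifold with boundary. -/
  W : Type u
  /-- The topology of `W`. -/
  [topologicalSpace : TopologicalSpace W]
  /-- `W` is Hausdorff. -/
  [t2Space : T2Space W]
  /-- `W` is compact. -/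
  [compactSpace : CompactSpace W]
  /-- The atlas of `W`, modelled on the half-space. -/
  [chartedSpace : ChartedSpace (EuclideanHalfSpace (n + 1)) W]
  /-- The splitting of the boundary into the two ends. -/
  splitting : BoundarySplitting n M N W
  /-- The relative fundamental class. -/
  w : Literature.AlgebraicTopology.SingularHomology.relativeSingularHomology ℤ ℤ W ((𝓡∂ (n + 1)).boundary W) (n + 1)
  /-- `∂w = (iM)_*[M]_μ − (iN)_*[N]_ν`. -/
  δ_w : Literature.AlgebraicTopology.SingularHomology.relativeSingularHomology.δ ℤ ℤ W ((𝓡∂ (n + 1)).boundary W) n w =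
    Literature.AlgebraicTopology.SingularHomology.singularHomology.map ℤ ℤ splitting.iMB n μ.fundamentalClass -
      Literature.AlgebraicTopology.SingularHomology.singularHomology.map ℤ ℤ splitting.iNB n ν.fundamentalClass
  /-- `w` is a relative fundamental class of `(W, ∂W)`. -/
  isRelFundamentalClass : Literature.AlgebraicTopology.SingularHomology.IsRelFundamentalClass ℤ ((𝓡∂ (n + 1)).boundary W) w

attribute [instance] OrientedSplitting.topologicalSpace OrientedSplitting.t2Space
  OrientedSplitting.compactSpace OrientedSplitting.chartedSpace

section SPC4

/-- **The leaf `two_mul_boundaryImageRank_eq` (Thom 1952, Cor. V.8, `n = 4`, `p = 2`) from a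
normalization of the bordism datum and the textbook named facts.**  Hypothesis `hA1` is the
bookkeeping of the next layer (not a literature fact; it is what remains to be PROVED): every
homological oriented-bordism datum `(c, w)` between `(M, μ)` and `(N, ν)` can be replaced by one
in normal form (`Literature.Topology.FourManifolds.OrientedSplitting`: a relative fundamental class on a compact topological
5-manifold with boundary split as `M ⊔ N`) with the same `r₂` — classically: discard the
components of `c.W` not meeting `∂W` and use Spanier Thm. 6.3.5 on the others.  The remaining
hypotheses are the standard theorems, quantified over all spaces they will be used on: Lefschetz
duality (`hL`, Spanier 6.3.12 / Hatcher 3.43), finiteness for compact orientable manifolds with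
boundary (`hFW`, Spanier 6.2.21), universal coefficients (`hU1`, `hU2`, Hatcher 3.2), Poincaré
duality (`hD`, Hatcher 3.30) and finiteness (`hF…`, Hatcher A.8–A.9) for closed 4-manifolds.
PROVED (by `BoundarySplitting.two_mul_restrictRank_eq_of_isRelFundamentalClass`).
[cite: Thom1952, Cor. V.8 (p. 173)] -/
theorem two_mul_boundaryImageRank_eq_of_normalization
    (hA1 : ∀ {M N : Type u} [TopologicalSpace M] [T2Space M] [SecondCountableTopology M]
      [ChartedSpace (EuclideanSpace ℝ (Fin 4)) M] [CompactSpace M] [IsManifold (𝓡 4) ∞ M]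
      [TopologicalSpace N] [T2Space N] [SecondCountableTopology N]
      [ChartedSpace (EuclideanSpace ℝ (Fin 4)) N] [CompactSpace N] [IsManifold (𝓡 4) ∞ N]
      (μ : Literature.AlgebraicTopology.SingularHomology.HomologicalOrientation ℤ M 4) (ν : Literature.AlgebraicTopology.SingularHomology.HomologicalOrientation ℤ N 4) (c : Cobordism 4 M N)
      (w : ↥(Literature.AlgebraicTopology.SingularHomology.relativeSingularHomology ℤ ℤ c.W ((𝓡∂ (4 + 1)).boundary c.W) (4 + 1)))
      (_hw : Literature.AlgebraicTopology.SingularHomology.relativeSingularHomology.δ ℤ ℤ c.W ((𝓡∂ (4 + 1)).boundary c.W) 4 w =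
        Literature.AlgebraicTopology.SingularHomology.singularHomology.map ℤ ℤ c.inlBoundary 4 μ.fundamentalClass -
          Literature.AlgebraicTopology.SingularHomology.singularHomology.map ℤ ℤ c.inrBoundary 4 ν.fundamentalClass),
      ∃ d : OrientedSplitting 4 M N μ ν, c.boundaryImageRank ℤ 2 = d.splitting.restrictRank ℤ 2)
    (hL : ∀ {W : Type u} [TopologicalSpace W] [T2Space W] [CompactSpace W]
      [ChartedSpace (EuclideanHalfSpace (4 + 1)) W]
      (z : ↥(Literature.AlgebraicTopology.SingularHomology.relativeSingularHomology ℤ ℤ W ((𝓡∂ (4 + 1)).boundary W) (4 + 1)))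
      (hz : Literature.AlgebraicTopology.SingularHomology.IsRelFundamentalClass ℤ ((𝓡∂ (4 + 1)).boundary W) z),
      Literature.AlgebraicTopology.SingularHomology.bijective_relCapProduct_of_isRelFundamentalClass ℤ 4 W z hz (show 2 + (2 + 1) = 4 + 1 by rfl))
    (hFW : ∀ {W : Type u} [TopologicalSpace W] [T2Space W] [CompactSpace W]
      [ChartedSpace (EuclideanHalfSpace (4 + 1)) W]
      (z : ↥(Literature.AlgebraicTopology.SingularHomology.relativeSingularHomology ℤ ℤ W ((𝓡∂ (4 + 1)).boundary W) (4 + 1)))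
      (hz : Literature.AlgebraicTopology.SingularHomology.IsRelFundamentalClass ℤ ((𝓡∂ (4 + 1)).boundary W) z),
      Literature.AlgebraicTopology.SingularHomology.finite_singularHomology_of_isRelFundamentalClass ℤ 4 W z hz 2)
    (hU1 : ∀ {W : Type u} [TopologicalSpace W], Literature.AlgebraicTopology.SingularHomology.kroneckerMap_surjective ℤ W 2)
    (hU2 : ∀ {X : Type u} [TopologicalSpace X], Literature.AlgebraicTopology.SingularHomology.ker_kroneckerMap_le_torsion ℤ X 1)
    (hD : ∀ {P : Type u} [TopologicalSpace P] [T2Space P] [CompactSpace P]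
      [ChartedSpace (EuclideanSpace ℝ (Fin 4)) P] (π : Literature.AlgebraicTopology.SingularHomology.HomologicalOrientation ℤ P 4),
      Literature.AlgebraicTopology.SingularHomology.bijective_poincareDualityMap π two_add_two_eq_four)
    (hF2 : ∀ {P : Type u} [TopologicalSpace P] [T2Space P] [CompactSpace P]
      [ChartedSpace (EuclideanSpace ℝ (Fin 4)) P], Literature.AlgebraicTopology.SingularHomology.finite_singularCohomology_of_compactSpace ℤ P 4 2)
    (hF₂ : ∀ {P : Type u} [TopologicalSpace P] [T2Space P] [CompactSpace P]
      [ChartedSpace (EuclideanSpace ℝ (Fin 4)) P], Literature.AlgebraicTopology.SingularHomology.finite_singularHomology_of_compactSpace ℤ P 4 2)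
    (hF₁ : ∀ {P : Type u} [TopologicalSpace P] [T2Space P] [CompactSpace P]
      [ChartedSpace (EuclideanSpace ℝ (Fin 4)) P], Literature.AlgebraicTopology.SingularHomology.finite_singularHomology_of_compactSpace ℤ P 4 1) :
    two_mul_boundaryImageRank_eq.{u} := by
  intro M N _ _ _ _ _ _ _ _ _ _ _ _ μ ν c w hw
  obtain ⟨d, hd⟩ := hA1 μ ν c w hw
  rw [hd]
  exact d.splitting.two_mul_restrictRank_eq_of_isRelFundamentalClass μ ν d.w d.δ_w
    d.isRelFundamentalClass (hL _ _) (hD μ) (hD ν) hU1 (@hU2 _ _) hF2 hF2 hF₂ hF₂ hF₁ hF₁ (hFW _ _)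

/-- **spc4.S36 with the leaf `two_mul_boundaryImageRank_eq` discharged down to the
normalization `hA1` and textbook named facts** (assembly of Layers 1–3):
`isOrientedBordant_iff_signature_eq` from `hA1`, Lefschetz/Poincaré duality, universal
coefficients, finiteness, Sylvester (`hS`) and Thom's Thm IV.13 (`h₂`).  PROVED.
[cite: ThomCMH1954, Thm IV.1 and Thm IV.13; Thom1952, Cor. V.8] -/
theorem isOrientedBordant_iff_signature_eq_of_normalization
    (hA1 : ∀ {M N : Type u} [TopologicalSpace M] [T2Space M] [SecondCountableTopology M]
      [ChartedSpace (EuclideanSpace ℝ (Fin 4)) M] [CompactSpace M] [IsManifold (𝓡 4) ∞ M]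
      [TopologicalSpace N] [T2Space N] [SecondCountableTopology N]
      [ChartedSpace (EuclideanSpace ℝ (Fin 4)) N] [CompactSpace N] [IsManifold (𝓡 4) ∞ N]
      (μ : Literature.AlgebraicTopology.SingularHomology.HomologicalOrientation ℤ M 4) (ν : Literature.AlgebraicTopology.SingularHomology.HomologicalOrientation ℤ N 4) (c : Cobordism 4 M N)
      (w : ↥(Literature.AlgebraicTopology.SingularHomology.relativeSingularHomology ℤ ℤ c.W ((𝓡∂ (4 + 1)).boundary c.W) (4 + 1)))
      (_hw : Literature.AlgebraicTopology.SingularHomology.relativeSingularHomology.δ ℤ ℤ c.W ((𝓡∂ (4 + 1)).boundary c.W) 4 w =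
        Literature.AlgebraicTopology.SingularHomology.singularHomology.map ℤ ℤ c.inlBoundary 4 μ.fundamentalClass -
          Literature.AlgebraicTopology.SingularHomology.singularHomology.map ℤ ℤ c.inrBoundary 4 ν.fundamentalClass),
      ∃ d : OrientedSplitting 4 M N μ ν, c.boundaryImageRank ℤ 2 = d.splitting.restrictRank ℤ 2)
    (hL : ∀ {W : Type u} [TopologicalSpace W] [T2Space W] [CompactSpace W]
      [ChartedSpace (EuclideanHalfSpace (4 + 1)) W]
      (z : ↥(Literature.AlgebraicTopology.SingularHomology.relativeSingularHomology ℤ ℤ W ((𝓡∂ (4 + 1)).boundary W) (4 + 1)))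
      (hz : Literature.AlgebraicTopology.SingularHomology.IsRelFundamentalClass ℤ ((𝓡∂ (4 + 1)).boundary W) z),
      Literature.AlgebraicTopology.SingularHomology.bijective_relCapProduct_of_isRelFundamentalClass ℤ 4 W z hz (show 2 + (2 + 1) = 4 + 1 by rfl))
    (hFW : ∀ {W : Type u} [TopologicalSpace W] [T2Space W] [CompactSpace W]
      [ChartedSpace (EuclideanHalfSpace (4 + 1)) W]
      (z : ↥(Literature.AlgebraicTopology.SingularHomology.relativeSingularHomology ℤ ℤ W ((𝓡∂ (4 + 1)).boundary W) (4 + 1)))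
      (hz : Literature.AlgebraicTopology.SingularHomology.IsRelFundamentalClass ℤ ((𝓡∂ (4 + 1)).boundary W) z),
      Literature.AlgebraicTopology.SingularHomology.finite_singularHomology_of_isRelFundamentalClass ℤ 4 W z hz 2)
    (hU1 : ∀ {W : Type u} [TopologicalSpace W], Literature.AlgebraicTopology.SingularHomology.kroneckerMap_surjective ℤ W 2)
    (hU2 : ∀ {X : Type u} [TopologicalSpace X], Literature.AlgebraicTopology.SingularHomology.ker_kroneckerMap_le_torsion ℤ X 1)
    (hD : ∀ {P : Type u} [TopologicalSpace P] [T2Space P] [CompactSpace P]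
      [ChartedSpace (EuclideanSpace ℝ (Fin 4)) P] (π : Literature.AlgebraicTopology.SingularHomology.HomologicalOrientation ℤ P 4),
      Literature.AlgebraicTopology.SingularHomology.bijective_poincareDualityMap π two_add_two_eq_four)
    (hF2 : ∀ {P : Type u} [TopologicalSpace P] [T2Space P] [CompactSpace P]
      [ChartedSpace (EuclideanSpace ℝ (Fin 4)) P], Literature.AlgebraicTopology.SingularHomology.finite_singularCohomology_of_compactSpace ℤ P 4 2)
    (hF₂ : ∀ {P : Type u} [TopologicalSpace P] [T2Space P] [CompactSpace P]
      [ChartedSpace (EuclideanSpace ℝ (Fin 4)) P], Literature.AlgebraicTopology.SingularHomology.finite_singularHomology_of_compactSpace ℤ P 4 2)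
    (hF₁ : ∀ {P : Type u} [TopologicalSpace P] [T2Space P] [CompactSpace P]
      [ChartedSpace (EuclideanSpace ℝ (Fin 4)) P], Literature.AlgebraicTopology.SingularHomology.finite_singularHomology_of_compactSpace ℤ P 4 1)
    (hS : ∀ {P : Type u} [TopologicalSpace P] [T2Space P] [CompactSpace P]
      [ChartedSpace (EuclideanSpace ℝ (Fin 4)) P] (π : Literature.AlgebraicTopology.SingularHomology.HomologicalOrientation ℤ P 4),
      Literature.AlgebraicTopology.SingularHomology.sigPos_add_sigNeg_intersectionForm even_two two_add_two_eq_four π)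
    (h₂ : isOrientedBordant_of_signature_eq.{u}) : isOrientedBordant_iff_signature_eq.{u} :=
  isOrientedBordant_iff_signature_eq_of_boundaryImageRank
    (two_mul_boundaryImageRank_eq_of_normalization hA1 hL hFW hU1 (fun {X} _ => @hU2 X _) hD hF2 hF₂ hF₁)
    hS hF2 h₂

end SPC4

end Literature.Topology.FourManifolds

end
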